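import Mathlib.RingTheory.Ideal.Quotient.Index
import Mathlib.RingTheory.Nakayama
import Mathlib.RingTheory.DualNumber
import Mathlib.RingTheory.Artinian.Module
import Mathlib.LinearAlgebra.Dual.Basis
import Mathlib.FieldTheory.Finiteness
import Mathlib.CategoryTheory.CofilteredSystem
import Mathlib.CategoryTheory.Functor.OfSequence
import Literature.NumberTheory.GaloisRepresentations.DeformationFiniteLevel
import HarnessLib

/-!
# The universal ring of a lifting condition: the profinite level (Mazur §20 Prop. 1–2)

Topic `Literature/NumberTheory/GaloisRepresentations`.  Step 4 of the construction behind the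
named fact `nearlyOrdinaryDeformationRing_nonempty` (`NearlyOrdinaryDeformationRing.lean`;
Calegari–Mazur §2.2 → Mazur §30 → Mazur §20 Prop. 2).  For a lifting condition `𝒞` on the lifts
of `r̄ : Γ → GL_n(k)` (`Deformation.LiftingCondition`, file `DeformationFiniteLevel.lean`, where
the universal ring `R_U` at each finite level `Γ/U` is constructed) we pass to the profinite group
along a cofinal decreasing sequence `U₀ ≥ U₁ ≥ ⋯` of open normal subgroups of finite index, and
prove **Mazur's representability theorem**
`LiftingCondition.exists_universal_of_finite`: if `k` is finite and `𝒞(k[ε])` is finite (this is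
where Mazur's `p`-finiteness condition `Φ_p` enters), there is `R ∈ Ĉ_𝒪(k)` with an admissible
`ρ_R ∈ 𝒞(R)` through which every admissible lift factors uniquely.  Instead of Schlessinger's
criterion the ring is built explicitly as `R = lim_N R_{U_N}`, realised as a quotient
`Λ_d/J_∞` of a power series object (so that it is complete Noetherian local BY CONSTRUCTION):

* General commutative algebra (all proved): the complete Nakayama lemma in the cyclic case and the
  resulting surjectivity criterion (`exists_eq_smul_of_isAdicComplete`,
  `surjective_of_isAdicComplete`, `CNLAlgebra.surjective_of_maximalIdeal_le`; Matsumura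
  Thm. 8.4), Krull's closedness of ideals (`mem_of_forall_mem_sup_pow`), **Chevalley's lemma** for
  complete Noetherian local rings with finite residue field (`exists_le_pow_of_iInf_eq_bot`;
  Matsumura Ex. 8.7), Kőnig's lemma for sequences of finite sets
  (`exists_seq_compat_of_finite`, from Mathlib's `nonempty_sections_of_finite_inverse_system`).
* Sequential inverse systems in `Ĉ_𝒪(k)`: composite transitions (`transition`), cotangent
  generators `CotGen B s` (`𝔪_B = (s) + 𝔪_B² + 𝔭B`, `𝔭 = ker(𝒪 → k)`; Mazur §17), their
  transport, and compatible generating tuples along a surjective system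
  (`exists_compat_cotGen`, Kőnig); the limit object `limCNL = Λ_d/J_∞` with projections onto
  every `R_N`, jointly injective and ONTO THE COMPATIBLE FAMILIES (`exists_limProj_eq`,
  Chevalley + completeness).
* Tangent counting (`exists_cotGen_of_card_algHom_le`; Mazur §15, §17): if `B ∈ Ĉ_𝒪(k)` has at
  most `M` morphisms to the dual numbers `dualCNL = k[ε]`, then `𝔪_B/(𝔪_B² + 𝔭B)` is spanned by
  `M` elements (the `k`-dual of the cotangent space injects into `Hom(B, k[ε])`).
* The tower `lvl 𝒞 N = R_{U_N}` with SURJECTIVE transitions (`lvlTrans_surjective`), the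
  universal ring `univRing` and lift `univRep ∈ 𝒞(univRing)` (`univRep_mem`, continuity by
  Chevalley), its universal property (`existsUnique_univLift`), and the main theorem
  `exists_universal_of_finite` (uniform cotangent bound from `#𝒞(k[ε])` via `exists_cotGen_lvl`).

Everything is proved; no named facts.

## References

* [Maz] B. Mazur, *An introduction to the deformation theory of Galois representations*, in
  Modular Forms and Fermat's Last Theorem (Springer 1997), §15 (Zariski tangent space and
  `k[ε]`), §17, §20 Prop. 1 (continuity) and Prop. 2 (representability).
  [cite: Mazur1997Deformation, §20 Prop. 2]
* H. Matsumura, *Commutative Ring Theory*, CUP 1986, Thm. 8.4, Thm. 8.10, Exercise 8.7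
  (Chevalley's theorem). [cite: Matsumura1987, Thm. 8.4]
-/

noncomputable section

open IsLocalRing Matrix DualNumber TrivSqZeroExt

namespace Literature.NumberTheory.GaloisRepresentations.Deformation

universe u


/-! ### Complete Nakayama (cyclic case) -/

section CompleteNakayama

variable {A : Type*} [CommRing A] {I : Ideal A} {M : Type*} [AddCommGroup M] [Module A M]

/-- One step of successive approximation: if `M = A x + I M` then
`I^j M ⊆ I^j x + I^{j+1} M`. [cite: Matsumura1987, Thm. 8.4] -/
theorem exists_sub_smul_mem_of_le_span_sup {x : M}
    (h : (⊤ : Submodule A M) ≤ Submodule.span A {x} ⊔ I • ⊤) (j : ℕ) {m : M}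
    (hm : m ∈ (I ^ j • ⊤ : Submodule A M)) :
    ∃ a ∈ I ^ j, m - a • x ∈ (I ^ (j + 1) • ⊤ : Submodule A M) := by
  have hle : (I ^ j • ⊤ : Submodule A M) ≤ I ^ j • Submodule.span A {x} ⊔ I ^ (j + 1) • ⊤ := by
    calc (I ^ j • ⊤ : Submodule A M) ≤ I ^ j • (Submodule.span A {x} ⊔ I • ⊤) :=
          Submodule.smul_mono le_rfl h
      _ = I ^ j • Submodule.span A {x} ⊔ I ^ (j + 1) • ⊤ := by
          rw [Submodule.smul_sup, ← Submodule.mul_smul, ← pow_succ]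
  obtain ⟨y, hy, z, hz, rfl⟩ := Submodule.mem_sup.1 (hle hm)
  obtain ⟨a, ha, rfl⟩ := (Submodule.mem_smul_span_singleton).1 hy
  exact ⟨a, ha, by simpa using hz⟩

/-- **Complete Nakayama lemma, cyclic case** (Matsumura, Thm. 8.4 with one generator): if `A` is
`I`-adically complete, `M` is `I`-adically separated and `M = A x + I M`, then `M = A x`.
[cite: Matsumura1987, Thm. 8.4] -/
theorem exists_eq_smul_of_isAdicComplete [IsAdicComplete I A] [IsHausdorff I M] {x : M}
    (h : (⊤ : Submodule A M) ≤ Submodule.span A {x} ⊔ I • ⊤) (m : M) : ∃ a : A, m = a • x := by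
  classical
  -- a total step function
  have step : ∀ (j : ℕ) (m' : M), ∃ a : A, m' ∈ (I ^ j • ⊤ : Submodule A M) →
      a ∈ I ^ j ∧ m' - a • x ∈ (I ^ (j + 1) • ⊤ : Submodule A M) := by
    intro j m'
    by_cases hm' : m' ∈ (I ^ j • ⊤ : Submodule A M)
    · obtain ⟨a, ha, h'⟩ := exists_sub_smul_mem_of_le_span_sup h j hm'
      exact ⟨a, fun _ => ⟨ha, h'⟩⟩
    · exact ⟨0, fun h' => absurd h' hm'⟩
  choose g hg using step
  -- the remainders and the coefficients
  let r : ℕ → M := fun j => Nat.rec m (fun i mi => mi - g i mi • x) j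
  have hr0 : r 0 = m := rfl
  have hrs : ∀ j, r (j + 1) = r j - g j (r j) • x := fun j => rfl
  have hrmem : ∀ j, r j ∈ (I ^ j • ⊤ : Submodule A M) := by
    intro j
    induction j with
    | zero => simp [hr0]
    | succ j ih => rw [hrs]; exact (hg j (r j) ih).2
  have hgmem : ∀ j, g j (r j) ∈ I ^ j := fun j => (hg j (r j) (hrmem j)).1
  let s : ℕ → A := fun j => ∑ i ∈ Finset.range j, g i (r i)
  have hsum : ∀ j, m = s j • x + r j := by
    intro j
    induction j with
    | zero => simp [s, hr0]
    | succ j ih =>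
      simp only [s, Finset.sum_range_succ, add_smul, hrs]
      rw [ih]
      abel
  -- `s` is Cauchy
  have hcauchy : ∀ {a b : ℕ}, a ≤ b → s a ≡ s b [SMOD (I ^ a • ⊤ : Submodule A A)] := by
    intro a b hab
    rw [SModEq.sub_mem, smul_eq_mul, Ideal.mul_top]
    have : s b - s a = ∑ i ∈ Finset.Ico a b, g i (r i) := by
      simp only [s]
      rw [Finset.sum_Ico_eq_sub _ hab]
    rw [← neg_sub, Ideal.neg_mem_iff, this]
    refine Ideal.sum_mem _ fun i hi => ?_
    exact Ideal.pow_le_pow_right (Finset.mem_Ico.1 hi).1 (hgmem i)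
  obtain ⟨L, hL⟩ := IsPrecomplete.prec (IsAdicComplete.toIsPrecomplete (I := I) (M := A)) hcauchy
  refine ⟨L, ?_⟩
  -- `m - L • x ∈ ⋂ I^j M = 0`
  rw [← sub_eq_zero]
  refine IsHausdorff.haus (inferInstance : IsHausdorff I M) _ fun j => ?_
  rw [SModEq.zero]
  have hj := hL j
  rw [SModEq.sub_mem, smul_eq_mul, Ideal.mul_top] at hj
  have : m - L • x = r j + (s j - L) • x := by rw [hsum j]; simp [sub_smul]; abel
  rw [this]
  exact Submodule.add_mem _ (hrmem j) (Submodule.smul_mem_smul hj Submodule.mem_top)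

/-- **Surjectivity criterion** (corollary of complete Nakayama): a ring homomorphism `f : A → B`
from an `I`-adically complete ring such that `B` is `f(I)B`-adically separated and
`B = f(A) + f(I)B` is onto. [cite: Matsumura1987, Thm. 8.4] -/
theorem surjective_of_isAdicComplete {B : Type*} [CommRing B] [IsAdicComplete I A] (f : A →+* B)
    [hB : IsHausdorff (I.map f) B] (h : ∀ b : B, ∃ a : A, b - f a ∈ I.map f) :
    Function.Surjective f := by
  letI : Algebra A B := f.toAlgebra
  have hsmul : ∀ (a : A) (b : B), a • b = f a * b := fun a b => Algebra.smul_def a b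
  haveI : IsHausdorff I B := by
    refine ⟨fun b hb => IsHausdorff.haus hB b fun n => ?_⟩
    have := hb n
    rw [SModEq.zero] at this ⊢
    rw [smul_eq_mul, Ideal.mul_top, ← Ideal.map_pow]
    rw [Ideal.smul_top_eq_map] at this
    exact this
  have htop : (⊤ : Submodule A B) ≤ Submodule.span A {(1 : B)} ⊔ I • ⊤ := by
    intro b _
    obtain ⟨a, ha⟩ := h b
    rw [Submodule.mem_sup]
    refine ⟨f a, Submodule.mem_span_singleton.2 ⟨a, ?_⟩, b - f a, ?_, by abel⟩
    · rw [hsmul, mul_one]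
    · rw [Ideal.smul_top_eq_map]
      exact ha
  intro b
  obtain ⟨a, ha⟩ := exists_eq_smul_of_isAdicComplete (I := I) htop b
  exact ⟨a, by rw [ha, hsmul, mul_one]⟩

end CompleteNakayama

/-! ### Krull: ideals of a Noetherian local ring are closed -/

section Krull

variable {A : Type*} [CommRing A] [IsNoetherianRing A] [IsLocalRing A]

/-- **Krull's intersection theorem for `A/J`**: `⋂ₙ (J + 𝔪ⁿ) = J` in a Noetherian local ring.
[cite: Matsumura1987, Thm. 8.10] -/
theorem mem_of_forall_mem_sup_pow {J : Ideal A} {x : A}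
    (h : ∀ n, x ∈ J ⊔ maximalIdeal A ^ n) : x ∈ J := by
  rw [← Ideal.Quotient.eq_zero_iff_mem]
  refine IsHausdorff.haus (inferInstance : IsHausdorff (maximalIdeal A) (A ⧸ J)) _ fun n => ?_
  rw [SModEq.zero, Ideal.smul_top_eq_map]
  change Ideal.Quotient.mk J x ∈ (maximalIdeal A ^ n).map (Ideal.Quotient.mk J)
  obtain ⟨y, hy, z, hz, rfl⟩ := Submodule.mem_sup.1 (h n)
  rw [map_add, Ideal.Quotient.eq_zero_iff_mem.2 hy, zero_add]
  exact Ideal.mem_map_of_mem _ hz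

/-- `⨅ₙ (J + 𝔪ⁿ) = J`. [cite: Matsumura1987, Thm. 8.10] -/
theorem iInf_sup_pow_eq (J : Ideal A) : ⨅ n, (J ⊔ maximalIdeal A ^ n) = J :=
  le_antisymm (fun _ hx => mem_of_forall_mem_sup_pow fun n => (Submodule.mem_iInf _).1 hx n)
    (le_iInf fun _ => le_sup_left)

end Krull

/-! ### Chevalley's lemma (finite residue field) -/

section Chevalley

variable {A : Type*} [CommRing A] [IsNoetherianRing A] [IsLocalRing A]

/-- An antitone sequence in a partial order taking finitely many values is eventually constant.
[folklore] -/
theorem exists_eventually_eq_of_antitone {α : Type*} [PartialOrder α] (f : ℕ → α)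
    (hf : Antitone f) (hfin : (Set.range f).Finite) : ∃ N, ∀ n ≥ N, f n = f N := by
  obtain ⟨_, ⟨N, rfl⟩, hmin⟩ := hfin.exists_minimal (Set.range_nonempty f)
  exact ⟨N, fun n hn => le_antisymm (hf hn) (hmin ⟨n, rfl⟩ (hf hn))⟩

variable [Finite (ResidueField A)]

/-- The ideals containing a fixed power of the maximal ideal are finite in number (finite residue
field). [folklore] -/
theorem finite_setOf_pow_le (m : ℕ) : {J : Ideal A | maximalIdeal A ^ m ≤ J}.Finite := by
  haveI : Finite (A ⧸ maximalIdeal A) := inferInstanceAs (Finite (ResidueField A))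
  haveI : Finite (A ⧸ maximalIdeal A ^ m) :=
    Ideal.finite_quotient_pow (I := maximalIdeal A) (IsNoetherian.noetherian _) m
  refine Set.Finite.of_finite_image (f := fun J => (J.map (Ideal.Quotient.mk (maximalIdeal A ^ m)) :
    Set (A ⧸ maximalIdeal A ^ m))) (Set.toFinite _) ?_
  intro J hJ J' hJ' h
  have h' : J.map (Ideal.Quotient.mk (maximalIdeal A ^ m)) =
      J'.map (Ideal.Quotient.mk (maximalIdeal A ^ m)) := SetLike.coe_injective h
  have := congrArg (Ideal.comap (Ideal.Quotient.mk (maximalIdeal A ^ m))) h'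
  rwa [Ideal.comap_map_of_surjective _ Ideal.Quotient.mk_surjective,
    Ideal.comap_map_of_surjective _ Ideal.Quotient.mk_surjective, ← RingHom.ker_eq_comap_bot,
    Ideal.mk_ker, sup_eq_left.2 hJ, sup_eq_left.2 hJ'] at this

variable [IsAdicComplete (maximalIdeal A) A]

/-- **Chevalley's lemma** (for a complete Noetherian local ring with finite residue field): a
decreasing sequence of ideals with zero intersection is eventually contained in any given power
of the maximal ideal. [cite: Matsumura1987, Exercise 8.7] -/
theorem exists_le_pow_of_iInf_eq_bot (J : ℕ → Ideal A) (hJ : Antitone J) (hinf : ⨅ n, J n = ⊥)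
    (m : ℕ) : ∃ N, J N ≤ maximalIdeal A ^ m := by
  -- stabilisation of `J n ⊔ 𝔪^m` for each `m`
  have hstab : ∀ m, ∃ N, ∀ n ≥ N, J n ⊔ maximalIdeal A ^ m = J N ⊔ maximalIdeal A ^ m := by
    intro m
    have hanti : Antitone (fun n => J n ⊔ maximalIdeal A ^ m) := by
      intro a b hab
      exact sup_le_sup_right (hJ hab) (maximalIdeal A ^ m)
    refine exists_eventually_eq_of_antitone (fun n => J n ⊔ maximalIdeal A ^ m) hanti ?_
    refine (finite_setOf_pow_le m).subset ?_
    rintro _ ⟨n, rfl⟩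
    exact (le_sup_right : maximalIdeal A ^ m ≤ J n ⊔ maximalIdeal A ^ m)
  choose N hN using hstab
  -- the stable values `L m`
  set L : ℕ → Ideal A := fun m => J (N m) ⊔ maximalIdeal A ^ m with hL
  have hLeq : ∀ m n, N m ≤ n → J n ⊔ maximalIdeal A ^ m = L m := fun m n hn => hN m n hn
  have hLsucc : ∀ m, L (m + 1) ⊔ maximalIdeal A ^ m = L m := by
    intro m
    have h1 := hLeq m (max (N m) (N (m + 1))) (le_max_left _ _)
    have h2 := hLeq (m + 1) (max (N m) (N (m + 1))) (le_max_right _ _)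
    rw [← h1, ← h2, sup_assoc,
      sup_eq_right.2 (Ideal.pow_le_pow_right (Nat.le_succ m) :
        maximalIdeal A ^ (m + 1) ≤ maximalIdeal A ^ m)]
  -- successive approximation inside the `L`'s
  have hstep : ∀ (j : ℕ) (x : A), ∃ y : A, x ∈ L (m + j) → y ∈ L (m + j + 1) ∧
      x - y ∈ maximalIdeal A ^ (m + j) := by
    intro j x
    by_cases hx : x ∈ L (m + j)
    · rw [← hLsucc (m + j)] at hx
      obtain ⟨y, hy, z, hz, rfl⟩ := Submodule.mem_sup.1 hx
      exact ⟨y, fun _ => ⟨hy, by simpa using hz⟩⟩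
    · exact ⟨0, fun h => absurd h hx⟩
  choose g hg using hstep
  -- the claim `L m ≤ 𝔪^m`
  suffices hclaim : L m ≤ maximalIdeal A ^ m by
    exact ⟨N m, le_trans le_sup_left (le_of_eq_of_le (hLeq m (N m) le_rfl) hclaim)⟩
  intro x hx
  let xs : ℕ → A := fun j => Nat.rec x (fun i xi => g i xi) j
  have hxs0 : xs 0 = x := rfl
  have hxss : ∀ j, xs (j + 1) = g j (xs j) := fun j => rfl
  have hxsmem : ∀ j, xs j ∈ L (m + j) := by
    intro j
    induction j with
    | zero => exact hx
    | succ j ih => rw [hxss]; exact (hg j (xs j) ih).1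
  have hxsdiff : ∀ j, xs j - xs (j + 1) ∈ maximalIdeal A ^ (m + j) := fun j => by
    rw [hxss]; exact (hg j (xs j) (hxsmem j)).2
  have hxsd : ∀ j d, xs j - xs (j + d) ∈ maximalIdeal A ^ (m + j) := by
    intro j d
    induction d with
    | zero => simp
    | succ d ih =>
      have : xs j - xs (j + (d + 1)) = (xs j - xs (j + d)) + (xs (j + d) - xs (j + d + 1)) := by
        rw [← add_assoc]; ring
      rw [this]
      exact Ideal.add_mem _ ih (Ideal.pow_le_pow_right (by omega) (hxsdiff (j + d)))
  have hxscauchy' : ∀ j l, j ≤ l → xs j - xs l ∈ maximalIdeal A ^ (m + j) := by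
    intro j l hjl
    obtain ⟨d, rfl⟩ := Nat.exists_eq_add_of_le hjl
    exact hxsd j d
  have hcauchy : ∀ {a b : ℕ}, a ≤ b → xs a ≡ xs b [SMOD (maximalIdeal A ^ a • ⊤ : Submodule A A)] :=
    fun {a b} hab => by
      rw [SModEq.sub_mem, smul_eq_mul, Ideal.mul_top]
      exact Ideal.pow_le_pow_right (Nat.le_add_left a m) (hxscauchy' a b hab)
  obtain ⟨y, hy⟩ := IsPrecomplete.prec (IsAdicComplete.toIsPrecomplete (I := maximalIdeal A) (M := A))
    hcauchy
  have hy' : ∀ j, xs j - y ∈ maximalIdeal A ^ j := fun j => by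
    have := hy j; rwa [SModEq.sub_mem, smul_eq_mul, Ideal.mul_top] at this
  -- upgrade: `xs j - y ∈ 𝔪^{m+j}`
  have hy'' : ∀ j, xs j - y ∈ maximalIdeal A ^ (m + j) := fun j => by
    have : xs j - y = (xs j - xs (m + j)) + (xs (m + j) - y) := by ring
    rw [this]
    exact Ideal.add_mem _ (hxscauchy' j (m + j) (Nat.le_add_left j m))
      (hy' (m + j))
  -- `y ∈ ⋂ J n = 0`
  have hy0 : y = 0 := by
    have : y ∈ ⨅ n, J n := by
      refine (Submodule.mem_iInf _).2 fun n => mem_of_forall_mem_sup_pow fun i => ?_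
      -- `xs i ∈ L (m+i) = J n' ⊔ 𝔪^{m+i}` with `n' = max n (N (m+i))`, and `J n' ≤ J n`
      have hmem : xs i ∈ J (max n (N (m + i))) ⊔ maximalIdeal A ^ (m + i) := by
        rw [hLeq (m + i) _ (le_max_right _ _)]; exact hxsmem i
      have : y = xs i - (xs i - y) := by ring
      rw [this]
      refine Ideal.sub_mem _ ?_ ?_
      · exact (sup_le_sup (hJ (le_max_left _ _)) (Ideal.pow_le_pow_right (Nat.le_add_left i m))) hmem
      · exact Ideal.mem_sup_right (Ideal.pow_le_pow_right (Nat.le_add_left i m) (hy'' i))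
    rwa [hinf, Submodule.mem_bot] at this
  have := hy'' 0
  rwa [hxs0, hy0, sub_zero, add_zero] at this

end Chevalley

/-! ### Kőnig's lemma for a sequence of finite nonempty types -/

section Konig

open CategoryTheory

/-- **Kőnig's lemma, sequential form**: an inverse system `S₀ ← S₁ ← S₂ ← ⋯` of nonempty finite
types has a compatible sequence of elements (Mathlib's
`nonempty_sections_of_finite_inverse_system`, specialised through `Functor.ofOpSequence`).
[folklore] -/
theorem exists_seq_compat_of_finite {S : ℕ → Type u} [∀ n, Finite (S n)] [∀ n, Nonempty (S n)]
    (f : ∀ n, S (n + 1) → S n) : ∃ x : ∀ n, S n, ∀ n, f n (x (n + 1)) = x n := by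
  let F : ℕᵒᵖ ⥤ Type u := Functor.ofOpSequence (X := S) fun n => TypeCat.ofHom (f n)
  haveI : ∀ j : ℕᵒᵖ, Finite (F.obj j) := fun j => inferInstanceAs (Finite (S j.unop))
  haveI : ∀ j : ℕᵒᵖ, Nonempty (F.obj j) := fun j => inferInstanceAs (Nonempty (S j.unop))
  obtain ⟨s, hs⟩ := nonempty_sections_of_finite_inverse_system F
  refine ⟨fun n => s (Opposite.op n), fun n => ?_⟩
  have h := hs ((homOfLE (Nat.le_add_right n 1)).op)
  have hmap := Functor.ofOpSequence_map_homOfLE_succ (X := S) (fun n => TypeCat.ofHom (f n)) n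
  rw [show F.map (homOfLE (Nat.le_add_right n 1)).op = TypeCat.ofHom (f n) from hmap] at h
  exact h

end Konig

/-! ### Sequential inverse systems of coefficient algebras -/

section InverseSystem

variable {𝒪 : Type u} [CommRing 𝒪] {k : Type u} [Field k] [Algebra 𝒪 k]
variable (R : ℕ → CNLAlgebra 𝒪 k) (t : ∀ N, R (N + 1) →ₐ[𝒪] R N)

/-- The composite transition maps `R N → R M` (`M ≤ N`) of a sequential inverse system.
[folklore] -/
def transition (M : ℕ) : ∀ {N : ℕ}, M ≤ N → (R N →ₐ[𝒪] R M) := fun h =>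
  Nat.leRec (motive := fun N _ => R N →ₐ[𝒪] R M) (AlgHom.id 𝒪 (R M))
    (fun N _ φ => φ.comp (t N)) h

/-- `transition M M = id`. [folklore] -/
@[simp] theorem transition_self (M : ℕ) : transition R t M (le_refl M) = AlgHom.id 𝒪 (R M) :=
  Nat.leRec_self _ _

/-- `transition M (N+1) = transition M N ∘ t N`. [folklore] -/
theorem transition_succ (M : ℕ) {N : ℕ} (h : M ≤ N) :
    transition R t M (Nat.le_succ_of_le h) = (transition R t M h).comp (t N) :=
  Nat.leRec_succ _ _ h

/-- `transition N (N+1) = t N`. [folklore] -/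
theorem transition_succ_self (N : ℕ) : transition R t N (Nat.le_succ N) = t N := by
  rw [transition_succ R t N le_rfl, transition_self, AlgHom.id_comp]

/-- A stepwise compatible sequence is compatible with all transition maps. [folklore] -/
theorem transition_apply_of_compat {s : ∀ N, R N} (hs : ∀ N, t N (s (N + 1)) = s N) (M : ℕ)
    {N : ℕ} (h : M ≤ N) : transition R t M h (s N) = s M := by
  induction h using Nat.leRec with
  | refl => simp
  | le_succ_of_le h ih => rw [transition_succ R t M h, AlgHom.comp_apply, hs, ih]

/-- Stepwise compatible maps out of a fixed algebra are compatible with all transitions.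
[folklore] -/
theorem transition_comp_of_compat {B : Type*} [CommRing B] [Algebra 𝒪 B] {ψ : ∀ N, B →ₐ[𝒪] R N}
    (hψ : ∀ N, (t N).comp (ψ (N + 1)) = ψ N) (M : ℕ) {N : ℕ} (h : M ≤ N) :
    (transition R t M h).comp (ψ N) = ψ M := by
  apply AlgHom.ext
  intro b
  exact transition_apply_of_compat R t (s := fun N => ψ N b) (fun N => DFunLike.congr_fun (hψ N) b) M h

/-- Transition maps of a system of surjections are surjective. [folklore] -/
theorem transition_surjective (ht : ∀ N, Function.Surjective (t N)) (M : ℕ) {N : ℕ} (h : M ≤ N) :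
    Function.Surjective (transition R t M h) := by
  induction h using Nat.leRec with
  | refl => simpa using Function.surjective_id
  | le_succ_of_le h ih =>
    rw [transition_succ R t M h, AlgHom.coe_comp]
    exact ih.comp (ht _)

end InverseSystem

/-! ### Cotangent generators -/

section Cotangent

variable {𝒪 : Type u} [CommRing 𝒪] {k : Type u} [Field k] [Algebra 𝒪 k]

/-- The residual kernel `𝔭 = ker(𝒪 → k)`. [folklore] -/
def resKer (𝒪 : Type u) [CommRing 𝒪] (k : Type u) [Field k] [Algebra 𝒪 k] : Ideal 𝒪 :=
  RingHom.ker (algebraMap 𝒪 k)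

/-- The ideal `𝔪_B² + 𝔭B` cutting out the relative cotangent space `𝔪_B/(𝔪_B² + 𝔭B)`.
[cite: Mazur1997Deformation, §17] -/
def cotIdeal (B : CNLAlgebra 𝒪 k) : Ideal B :=
  maximalIdeal B ^ 2 ⊔ (resKer 𝒪 k).map (algebraMap 𝒪 B)

/-- `𝔭B ⊆ 𝔪_B`. [folklore] -/
theorem map_resKer_le (B : CNLAlgebra 𝒪 k) : (resKer 𝒪 k).map (algebraMap 𝒪 B) ≤ maximalIdeal B := by
  rw [Ideal.map_le_iff_le_comap]
  intro o ho
  rw [Ideal.mem_comap, CNLAlgebra.mem_maximalIdeal_iff, AlgHom.commutes]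
  exact ho

/-- `𝔪_B² + 𝔭B ⊆ 𝔪_B`. [folklore] -/
theorem cotIdeal_le (B : CNLAlgebra 𝒪 k) : cotIdeal B ≤ maximalIdeal B :=
  sup_le (Ideal.pow_le_self two_ne_zero) (map_resKer_le B)

/-- `𝔪_B² + 𝔭B` is proper. [folklore] -/
theorem cotIdeal_ne_top (B : CNLAlgebra 𝒪 k) : cotIdeal B ≠ ⊤ := fun h =>
  (maximalIdeal.isMaximal B).ne_top (top_le_iff.1 (h ▸ cotIdeal_le B))

/-- A surjective morphism maps `𝔪_A² + 𝔭A` onto `𝔪_B² + 𝔭B`. [folklore] -/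
theorem map_cotIdeal {A B : CNLAlgebra 𝒪 k} (φ : A →ₐ[𝒪] B) (hφ : Function.Surjective φ) :
    (cotIdeal A).map (φ : A →+* B) = cotIdeal B := by
  rw [cotIdeal, cotIdeal, Ideal.map_sup, Ideal.map_pow, Ideal.map_map,
    IsLocalRing.map_maximalIdeal_of_surjective (φ : A →+* B) hφ, φ.comp_algebraMap]

/-- `s : Fin d → B` **generates the cotangent space**: the `s i` lie in `𝔪_B` and
`𝔪_B = (s) + 𝔪_B² + 𝔭B`. [cite: Mazur1997Deformation, §17] -/
def CotGen (B : CNLAlgebra 𝒪 k) {ι : Type*} (s : ι → B) : Prop :=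
  (∀ i, s i ∈ maximalIdeal B) ∧ maximalIdeal B ≤ Ideal.span (Set.range s) ⊔ cotIdeal B

/-- Cotangent generation is preserved by surjective morphisms. [folklore] -/
theorem CotGen.map {A B : CNLAlgebra 𝒪 k} {ι : Type*} {s : ι → A} (h : CotGen A s)
    (φ : A →ₐ[𝒪] B) (hφ : Function.Surjective φ) : CotGen B (φ ∘ s) := by
  refine ⟨fun i => ?_, ?_⟩
  · rw [← IsLocalRing.map_maximalIdeal_of_surjective (φ : A →+* B) hφ]
    exact Ideal.mem_map_of_mem _ (h.1 i)
  · rw [← IsLocalRing.map_maximalIdeal_of_surjective (φ : A →+* B) hφ]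
    calc (maximalIdeal A).map (φ : A →+* B)
        ≤ (Ideal.span (Set.range s) ⊔ cotIdeal A).map (φ : A →+* B) := Ideal.map_mono h.2
      _ = Ideal.span (Set.range (φ ∘ s)) ⊔ cotIdeal B := by
          rw [Ideal.map_sup, Ideal.map_span, map_cotIdeal φ hφ, Set.range_comp]
          rfl

/-- Cotangent generation only depends on the classes modulo `𝔪_B² + 𝔭B`. [folklore] -/
theorem CotGen.of_sub_mem {B : CNLAlgebra 𝒪 k} {ι : Type*} {s s' : ι → B} (h : CotGen B s)
    (hs' : ∀ i, s i - s' i ∈ cotIdeal B) : CotGen B s' := by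
  refine ⟨fun i => ?_, ?_⟩
  · have : s' i = s i - (s i - s' i) := by ring
    rw [this]
    exact Ideal.sub_mem _ (h.1 i) (cotIdeal_le B (hs' i))
  · refine le_trans h.2 (sup_le ?_ le_sup_right)
    rw [Ideal.span_le]
    rintro _ ⟨i, rfl⟩
    have : s i = s' i + (s i - s' i) := by ring
    rw [this]
    exact Ideal.add_mem _ (Ideal.mem_sup_left (Ideal.subset_span ⟨i, rfl⟩))
      (Ideal.mem_sup_right (hs' i))

/-- Cotangent generation is insensitive to reindexing along a surjection. [folklore] -/
theorem CotGen.comp_surjective {B : CNLAlgebra 𝒪 k} {ι ι' : Type*} {s : ι → B} (h : CotGen B s)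
    {e : ι' → ι} (he : Function.Surjective e) : CotGen B (s ∘ e) :=
  ⟨fun i => h.1 (e i), by rw [Set.range_comp, he.range_eq, Set.image_univ]; exact h.2⟩

/-- **Surjectivity criterion in `Ĉ_𝒪(k)`** (complete Nakayama): a morphism `φ : A → B` with
`𝔪_B ⊆ φ(𝔪_A)B + 𝔪_B²` is onto. [cite: Matsumura1987, Thm. 8.4] -/
theorem CNLAlgebra.surjective_of_maximalIdeal_le (hk : Function.Surjective (algebraMap 𝒪 k))
    {A B : CNLAlgebra 𝒪 k} (φ : A →ₐ[𝒪] B)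
    (h : maximalIdeal B ≤ (maximalIdeal A).map (φ : A →+* B) ⊔ maximalIdeal B ^ 2) :
    Function.Surjective φ := by
  have hmap : (maximalIdeal A).map (φ : A →+* B) = maximalIdeal B := by
    refine le_antisymm (CNLAlgebra.map_maximalIdeal_le hk φ) ?_
    refine Submodule.le_of_le_smul_of_le_jacobson_bot (IsNoetherian.noetherian _)
      (IsLocalRing.maximalIdeal_le_jacobson _) ?_
    rwa [Ideal.smul_eq_mul, ← sq]
  haveI : IsHausdorff ((maximalIdeal A).map (φ : A →+* B)) B := by rw [hmap]; infer_instance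
  refine surjective_of_isAdicComplete (I := maximalIdeal A) (φ : A →+* B) fun b => ?_
  obtain ⟨o, ho⟩ := hk (B.residue b)
  refine ⟨algebraMap 𝒪 _ o, ?_⟩
  rw [hmap, CNLAlgebra.mem_maximalIdeal_iff, map_sub, RingHom.coe_coe, AlgHom.commutes,
    AlgHom.commutes, ho, sub_self]

/-- A morphism whose image contains cotangent generators of the target is onto. [folklore] -/
theorem CotGen.surjective_of_range (hk : Function.Surjective (algebraMap 𝒪 k))
    {A B : CNLAlgebra 𝒪 k} {ι : Type*} {s : ι → B} (h : CotGen B s) (φ : A →ₐ[𝒪] B)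
    (hs : ∀ i, ∃ a ∈ maximalIdeal A, φ a = s i) : Function.Surjective φ := by
  refine CNLAlgebra.surjective_of_maximalIdeal_le hk φ (le_trans h.2 (sup_le ?_ ?_))
  · rw [Ideal.span_le]
    rintro _ ⟨i, rfl⟩
    obtain ⟨a, ha, hai⟩ := hs i
    exact Ideal.mem_sup_left (hai ▸ Ideal.mem_map_of_mem _ ha)
  · refine sup_le le_sup_right (le_trans ?_ le_sup_left)
    have : (resKer 𝒪 k).map (algebraMap 𝒪 B) =
        ((resKer 𝒪 k).map (algebraMap 𝒪 A)).map (φ : A →+* B) := by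
      rw [Ideal.map_map, φ.comp_algebraMap]
    rw [this]
    exact Ideal.map_mono (map_resKer_le A)

variable [Finite k]

/-- The ring `B/(𝔪_B² + 𝔭B)` is finite (finite residue field). [folklore] -/
theorem finite_quotient_cotIdeal (B : CNLAlgebra 𝒪 k) : Finite (B ⧸ cotIdeal B) := by
  haveI : Finite (B ⧸ maximalIdeal B) := by
    refine Finite.of_injective (Ideal.Quotient.lift (maximalIdeal B) (B.residue : B →+* k)
      fun a ha => (B.mem_maximalIdeal_iff).1 ha) ?_
    exact RingHom.lift_injective_of_ker_le_ideal _ (fun a ha => (B.mem_maximalIdeal_iff).1 ha)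
      (le_of_eq B.ker_residue)
  haveI : Finite (B ⧸ maximalIdeal B ^ 2) :=
    Ideal.finite_quotient_pow (I := maximalIdeal B) (IsNoetherian.noetherian _) 2
  exact Finite.of_surjective (Ideal.Quotient.factor (le_sup_left : maximalIdeal B ^ 2 ≤ cotIdeal B))
    (Ideal.Quotient.factor_surjective _)

/-- The residue ring `A/𝔪_A` of an object of `Ĉ_𝒪(k)` is finite when `k` is. [folklore] -/
theorem CNLAlgebra.finite_residueField (B : CNLAlgebra 𝒪 k) : Finite (ResidueField B) := by
  refine Finite.of_injective (Ideal.Quotient.lift (maximalIdeal B) (B.residue : B →+* k)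
    fun a ha => (B.mem_maximalIdeal_iff).1 ha) ?_
  exact RingHom.lift_injective_of_ker_le_ideal _ (fun a ha => (B.mem_maximalIdeal_iff).1 ha)
    (le_of_eq B.ker_residue)

/-! #### Compatible cotangent generators along a surjective inverse system (Kőnig) -/

variable (R : ℕ → CNLAlgebra 𝒪 k) (t : ∀ N, R (N + 1) →ₐ[𝒪] R N)
  (ht : ∀ N, Function.Surjective (t N)) {d : ℕ}

/-- The reduced transition maps `R_{N+1}/(𝔪² + 𝔭) → R_N/(𝔪² + 𝔭)`. [folklore] -/
def cotQuotMap (N : ℕ) : (R (N + 1) ⧸ cotIdeal (R (N + 1))) →+* (R N ⧸ cotIdeal (R N)) :=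
  Ideal.quotientMap (cotIdeal (R N)) (t N : R (N + 1) →+* R N) (by
    rw [← Ideal.map_le_iff_le_comap, map_cotIdeal (t N) (ht N)])

omit [Finite k] in
/-- `cotQuotMap` on residue classes. [folklore] -/
theorem cotQuotMap_mk (N : ℕ) (x : R (N + 1)) :
    cotQuotMap R t ht N (Ideal.Quotient.mk _ x) = Ideal.Quotient.mk _ (t N x) :=
  Ideal.quotientMap_mk

/-- The finite sets of cotangent-generating `d`-tuples modulo `𝔪² + 𝔭`. [folklore] -/
def CotTuples (N : ℕ) : Type u :=
  {w : Fin d → R N ⧸ cotIdeal (R N) //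
    ∃ s : Fin d → R N, CotGen (R N) s ∧ ∀ i, Ideal.Quotient.mk _ (s i) = w i}

/-- The transition `CotTuples (N+1) → CotTuples N`. [folklore] -/
def cotTuplesMap (N : ℕ) (w : CotTuples R (d := d) (N + 1)) : CotTuples R (d := d) N :=
  ⟨fun i => cotQuotMap R t ht N (w.1 i), by
    obtain ⟨s, hs, hsw⟩ := w.2
    refine ⟨t N ∘ s, hs.map (t N) (ht N), fun i => ?_⟩
    rw [Function.comp_apply, ← cotQuotMap_mk R t ht N, hsw]⟩

include ht in
/-- **Compatible cotangent generators.**  If every `R_N` admits `d` cotangent generators and the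
transition maps are surjective, there are compatible `d`-tuples of cotangent generators
(Kőnig's lemma on the finite sets of generating tuples modulo `𝔪² + 𝔭`, then successive
correction). [folklore] -/
theorem exists_compat_cotGen (hgen : ∀ N, ∃ s : Fin d → R N, CotGen (R N) s) :
    ∃ x : ∀ N, Fin d → R N, (∀ N, CotGen (R N) (x N)) ∧ ∀ N i, t N (x (N + 1) i) = x N i := by
  classical
  haveI : ∀ N, Finite (CotTuples R (d := d) N) := fun N => by
    haveI := finite_quotient_cotIdeal (R N)
    exact Subtype.finite
  haveI : ∀ N, Nonempty (CotTuples R (d := d) N) := fun N => by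
    obtain ⟨s, hs⟩ := hgen N
    exact ⟨⟨fun i => Ideal.Quotient.mk _ (s i), s, hs, fun _ => rfl⟩⟩
  obtain ⟨w, hw⟩ := exists_seq_compat_of_finite (S := CotTuples R (d := d)) (cotTuplesMap R t ht)
  have hw' : ∀ N i, cotQuotMap R t ht N ((w (N + 1)).1 i) = (w N).1 i := fun N i => by
    have := congrArg (fun v : CotTuples R (d := d) N => v.1 i) (hw N)
    exact this
  -- successive correction
  have step : ∀ (N : ℕ) (xN : Fin d → R N), (∀ i, Ideal.Quotient.mk _ (xN i) = (w N).1 i) →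
      ∃ x' : Fin d → R (N + 1), CotGen (R (N + 1)) x' ∧
        (∀ i, Ideal.Quotient.mk _ (x' i) = (w (N + 1)).1 i) ∧ ∀ i, t N (x' i) = xN i := by
    intro N xN hxN
    obtain ⟨s', hs', hs'w⟩ := (w (N + 1)).2
    have hdiff : ∀ i, t N (s' i) - xN i ∈ (cotIdeal (R (N + 1))).map (t N : R (N + 1) →+* R N) := by
      intro i
      rw [map_cotIdeal (t N) (ht N), ← Ideal.Quotient.eq, ← cotQuotMap_mk R t ht N, hs'w, hw', hxN]
    choose c hc hc' using fun i => (Ideal.mem_map_iff_of_surjective _ (ht N)).1 (hdiff i)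
    refine ⟨fun i => s' i - c i, hs'.of_sub_mem (fun i => by simpa using hc i), fun i => ?_, fun i => ?_⟩
    · rw [← hs'w i, eq_comm, Ideal.Quotient.eq]
      simpa using hc i
    · rw [map_sub]
      have h' : t N (c i) = t N (s' i) - xN i := hc' i
      rw [h']
      ring
  choose stepF hstepGen hstepW hstepT using step
  -- level zero
  obtain ⟨s0, hs0, hs0w⟩ := (w 0).2
  -- the recursion, carrying the invariant `mk ∘ x N = w N`
  let B : ∀ N, {x : Fin d → R N // ∀ i, Ideal.Quotient.mk _ (x i) = (w N).1 i} := fun N =>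
    Nat.rec (motive := fun N => {x : Fin d → R N // ∀ i, Ideal.Quotient.mk _ (x i) = (w N).1 i})
      ⟨s0, hs0w⟩ (fun N xN => ⟨stepF N xN.1 xN.2, hstepW N xN.1 xN.2⟩) N
  have hBsucc : ∀ N, (B (N + 1)).1 = stepF N (B N).1 (B N).2 := fun N => rfl
  refine ⟨fun N => (B N).1, fun N => ?_, fun N i => ?_⟩
  · cases N with
    | zero => exact hs0
    | succ N =>
      change CotGen (R (N + 1)) (B (N + 1)).1
      rw [hBsucc]; exact hstepGen N _ _
  · change t N ((B (N + 1)).1 i) = (B N).1 i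
    rw [hBsucc]; exact hstepT N _ _ i

end Cotangent

/-! ### The limit of a surjective system with bounded cotangent dimension -/

section LimitRing

variable {𝒪 : Type u} [CommRing 𝒪] {k : Type u} [Field k] [Algebra 𝒪 k]
variable (hk : Function.Surjective (algebraMap 𝒪 k)) [IsNoetherianRing 𝒪]
variable (R : ℕ → CNLAlgebra 𝒪 k) (t : ∀ N, R (N + 1) →ₐ[𝒪] R N) {d : ℕ}
  (x : ∀ N, Fin d → R N) (hx : ∀ N, CotGen (R N) (x N)) (hxt : ∀ N i, t N (x (N + 1) i) = x N i)

/-- The index type `{y₁, …, y_d}` of the power series variables (in universe `u`). [folklore] -/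
abbrev PSVars (d : ℕ) : Type u := ULift.{u} (Fin d)

/-- The power series object `Λ_d = 𝒪[[y₁, …, y_d]]` (completed polynomial algebra at `0`).
[cite: Mazur1997Deformation, §2] -/
abbrev powerSeriesCNL (d : ℕ) : CNLAlgebra 𝒪 k :=
  PowerSeriesAt.toCNL (fun _ : PSVars.{u} d => (0 : k)) hk

include hx in
omit [IsNoetherianRing 𝒪] in
/-- The cotangent generators reduce to `0`. [folklore] -/
theorem residue_x (N : ℕ) (i : PSVars.{u} d) :
    (R N).residue (x N i.down) = (fun _ : PSVars.{u} d => (0 : k)) i :=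
  ((R N).mem_maximalIdeal_iff).1 ((hx N).1 i.down)

/-- The maps `ψ_N : Λ_d → R_N`, `y_i ↦ x_{N,i}`. [folklore] -/
def psi (N : ℕ) : powerSeriesCNL hk d →ₐ[𝒪] R N :=
  PowerSeriesAt.lift (R N) (fun i : PSVars.{u} d => x N i.down) (residue_x R x hx N)

/-- `ψ_N (y_i) = x_{N,i}`. [folklore] -/
theorem psi_X (N : ℕ) (i : PSVars.{u} d) :
    psi hk R x hx N (PowerSeriesAt.X 𝒪 (fun _ : PSVars.{u} d => (0 : k)) i) = x N i.down :=
  PowerSeriesAt.lift_X _ _ _ i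

include hxt in
/-- Compatibility `t_N ∘ ψ_{N+1} = ψ_N`. [folklore] -/
theorem t_comp_psi (N : ℕ) : (t N).comp (psi hk R x hx (N + 1)) = psi hk R x hx N := by
  refine PowerSeriesAt.lift_unique hk (R N) (fun i : PSVars.{u} d => x N i.down)
    (residue_x R x hx N) _ fun i => ?_
  change t N (psi hk R x hx (N + 1) (PowerSeriesAt.X 𝒪 _ i)) = _
  rw [psi_X, hxt]

/-- **`ψ_N : Λ_d → R_N` is onto** (complete Nakayama). [cite: Matsumura1987, Thm. 8.4] -/
theorem psi_surjective (N : ℕ) : Function.Surjective (psi hk R x hx N) := by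
  refine ((hx N).comp_surjective (e := fun i : PSVars.{u} d => i.down)
    (fun i => ⟨⟨i⟩, rfl⟩)).surjective_of_range hk (psi hk R x hx N) fun i => ?_
  refine ⟨PowerSeriesAt.X 𝒪 _ i, ?_, psi_X hk R x hx N i⟩
  rw [CNLAlgebra.mem_maximalIdeal_iff]
  exact PowerSeriesAt.residue_X 𝒪 _ _

/-- The kernels `J_N = ker ψ_N`. [folklore] -/
def kerPsi (N : ℕ) : Ideal (powerSeriesCNL hk d) := RingHom.ker (psi hk R x hx N).toRingHom

include hxt in
/-- The kernels decrease. [folklore] -/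
theorem kerPsi_antitone : Antitone (kerPsi hk R x hx) := by
  refine antitone_nat_of_succ_le fun N => ?_
  intro f hf
  change psi hk R x hx N f = 0
  rw [← t_comp_psi hk R t x hx hxt N, AlgHom.comp_apply]
  change psi hk R x hx (N + 1) f = 0 at hf
  rw [hf, map_zero]

/-- The limit ideal `J_∞ = ⋂ J_N`. [folklore] -/
def kerLim : Ideal (powerSeriesCNL hk d) := ⨅ N, kerPsi hk R x hx N

/-- `J_∞ ≤ J_N`. [folklore] -/
theorem kerLim_le (N : ℕ) : kerLim hk R x hx ≤ kerPsi hk R x hx N := iInf_le _ N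

/-- `J_∞` is proper. [folklore] -/
theorem kerLim_ne_top : kerLim hk R x hx ≠ ⊤ := fun h => by
  have : (1 : powerSeriesCNL hk d) ∈ kerPsi hk R x hx 0 := kerLim_le hk R x hx 0 (h ▸ Submodule.mem_top)
  change psi hk R x hx 0 1 = 0 at this
  rw [map_one] at this
  exact one_ne_zero this

/-- **The limit object** `R_∞ = Λ_d / J_∞` of `Ĉ_𝒪(k)` — a complete Noetherian local `𝒪`-algebra
with residue field `k` BY CONSTRUCTION; it will be identified with `lim R_N` through the
projections `limProj`. [cite: Mazur1997Deformation, §20 Prop. 1] -/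
def limCNL : CNLAlgebra 𝒪 k := (powerSeriesCNL hk d).quotient (kerLim hk R x hx) (kerLim_ne_top hk R x hx)

/-- The projections `π_N : R_∞ → R_N`. [folklore] -/
def limProj (N : ℕ) : limCNL hk R x hx →ₐ[𝒪] R N :=
  Ideal.Quotient.liftₐ (kerLim hk R x hx) (psi hk R x hx N) fun _ hf => kerLim_le hk R x hx N hf

/-- `π_N` on residue classes. [folklore] -/
theorem limProj_mk (N : ℕ) (f : powerSeriesCNL hk d) :
    limProj hk R x hx N (Ideal.Quotient.mk _ f) = psi hk R x hx N f := rfl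

include hxt in
/-- Compatibility `t_N ∘ π_{N+1} = π_N`. [folklore] -/
theorem t_comp_limProj (N : ℕ) : (t N).comp (limProj hk R x hx (N + 1)) = limProj hk R x hx N := by
  refine Ideal.Quotient.algHom_ext 𝒪 (AlgHom.ext fun f => ?_)
  change t N (psi hk R x hx (N + 1) f) = psi hk R x hx N f
  rw [← t_comp_psi hk R t x hx hxt N]
  rfl

/-- The projections are onto. [folklore] -/
theorem limProj_surjective (N : ℕ) : Function.Surjective (limProj hk R x hx N) := fun b => by
  obtain ⟨f, rfl⟩ := psi_surjective hk R x hx N b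
  exact ⟨Ideal.Quotient.mk _ f, rfl⟩

/-- The projections are jointly injective (`J_∞ = ⋂ J_N`). [folklore] -/
theorem limProj_jointly_injective (q : limCNL hk R x hx) (h : ∀ N, limProj hk R x hx N q = 0) :
    q = 0 := by
  obtain ⟨f, rfl⟩ := Ideal.Quotient.mk_surjective q
  change Ideal.Quotient.mk (kerLim hk R x hx) f = 0
  rw [Ideal.Quotient.eq_zero_iff_mem, kerLim, Submodule.mem_iInf]
  exact fun N => h N

/-- `⋂ ker π_N = 0`. [folklore] -/
theorem iInf_ker_limProj :
    ⨅ N, RingHom.ker (limProj hk R x hx N).toRingHom = (⊥ : Ideal (limCNL hk R x hx)) := by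
  rw [eq_bot_iff]
  intro q hq
  rw [Submodule.mem_bot]
  exact limProj_jointly_injective hk R x hx q fun N => (Submodule.mem_iInf _).1 hq N

include hxt in
/-- The kernels of the projections decrease. [folklore] -/
theorem ker_limProj_antitone : Antitone fun N => RingHom.ker (limProj hk R x hx N).toRingHom := by
  refine antitone_nat_of_succ_le fun N => ?_
  intro q hq
  change limProj hk R x hx N q = 0
  rw [← t_comp_limProj hk R t x hx hxt N, AlgHom.comp_apply]
  change limProj hk R x hx (N + 1) q = 0 at hq
  rw [hq, map_zero]

variable [Finite k]

include hxt in
/-- **Chevalley for the projections**: `ker π_N ⊆ 𝔪_∞^m` for `N` large. [cite: Matsumura1987, Exercise 8.7] -/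
theorem exists_ker_limProj_le (m : ℕ) :
    ∃ N, RingHom.ker (limProj hk R x hx N).toRingHom ≤ maximalIdeal (limCNL hk R x hx) ^ m := by
  haveI := CNLAlgebra.finite_residueField (limCNL hk R x hx)
  exact exists_le_pow_of_iInf_eq_bot _ (ker_limProj_antitone hk R t x hx hxt)
    (iInf_ker_limProj hk R x hx) m

include hxt in
/-- **`R_∞` surjects onto the compatible families** (`R_∞ = lim R_N` as sets): every
`t`-compatible sequence `(s_N ∈ R_N)` comes from an element of `R_∞` (Chevalley's lemma and
completeness of `R_∞`). [cite: Mazur1997Deformation, §20 Prop. 1] -/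
theorem exists_limProj_eq (s : ∀ N, R N) (hs : ∀ N, t N (s (N + 1)) = s N) :
    ∃ q : limCNL hk R x hx, ∀ N, limProj hk R x hx N q = s N := by
  classical
  set L := limCNL hk R x hx with hL
  -- preimages at each level
  choose f hf using fun N => psi_surjective hk R x hx N (s N)
  -- Chevalley indices, made monotone and ≥ id
  choose n hn using exists_ker_limProj_le hk R t x hx hxt
  let ν : ℕ → ℕ := fun m => m + ∑ i ∈ Finset.range (m + 1), n i
  have hνn : ∀ m, n m ≤ ν m := fun m => by
    have : n m ≤ ∑ i ∈ Finset.range (m + 1), n i :=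
      Finset.single_le_sum (f := n) (fun _ _ => Nat.zero_le _) (Finset.self_mem_range_succ m)
    simp only [ν]; omega
  have hνid : ∀ m, m ≤ ν m := fun m => Nat.le_add_right _ _
  have hνmono : Monotone ν := fun a b hab => by
    simp only [ν]
    exact Nat.add_le_add hab (Finset.sum_le_sum_of_subset (Finset.range_mono (by omega)))
  -- compatibility of the preimages across levels: `ψ_M (f M') = s M` for `M ≤ M'`
  have hcompat : ∀ M M', M ≤ M' → psi hk R x hx M (f M') = s M := by
    intro M M' h
    have h1 := transition_comp_of_compat R t (ψ := psi hk R x hx) (t_comp_psi hk R t x hx hxt) M h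
    rw [← h1, AlgHom.comp_apply, hf, transition_apply_of_compat R t hs M h]
  -- the Cauchy sequence `g m = [f (ν m)]`
  let g : ℕ → L := fun m => Ideal.Quotient.mk _ (f (ν m))
  have hgker : ∀ m m', m ≤ m' → g m - g m' ∈ RingHom.ker (limProj hk R x hx (ν m)).toRingHom := by
    intro m m' h
    change limProj hk R x hx (ν m) (g m - g m') = 0
    simp only [g, map_sub, limProj_mk]
    rw [hcompat _ _ le_rfl, hcompat _ _ (hνmono h), sub_self]
  have hcauchy : ∀ {a b : ℕ}, a ≤ b → g a ≡ g b [SMOD (maximalIdeal L ^ a • ⊤ : Submodule L L)] := by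
    intro a b hab
    rw [SModEq.sub_mem, smul_eq_mul, Ideal.mul_top]
    exact hn a (ker_limProj_antitone hk R t x hx hxt (hνn a) (hgker a b hab))
  obtain ⟨q, hq⟩ := IsPrecomplete.prec (IsAdicComplete.toIsPrecomplete (I := maximalIdeal L) (M := L))
    hcauchy
  have hq' : ∀ m, g m - q ∈ maximalIdeal L ^ m := fun m => by
    have := hq m; rwa [SModEq.sub_mem, smul_eq_mul, Ideal.mul_top] at this
  refine ⟨q, fun N => ?_⟩
  -- `π_N q - s N ∈ ⋂_m 𝔪^m = 0`
  rw [← sub_eq_zero]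
  refine mem_of_forall_mem_sup_pow (J := (⊥ : Ideal (R N))) (fun m => ?_) |> fun h => by
    simpa using h
  rw [bot_sup_eq]
  -- use the level `max m N`
  have hmN : N ≤ ν (max m N) := le_trans (le_max_right _ _) (hνid _)
  have h1 : limProj hk R x hx N (g (max m N)) = s N := by
    simp only [g, limProj_mk]; exact hcompat _ _ hmN
  have : limProj hk R x hx N q - s N = -(limProj hk R x hx N (g (max m N) - q)) := by
    rw [map_sub, h1]; ring
  rw [this, Ideal.neg_mem_iff]
  refine Ideal.pow_le_pow_right (le_max_left m N) ?_
  exact CNLAlgebra.map_pow_maximalIdeal_le hk (A := L) (B := R N) (limProj hk R x hx N) _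
    (Ideal.mem_map_of_mem _ (hq' _))

end LimitRing

section TangentCounting

variable {𝒪 : Type u} [CommRing 𝒪] {k : Type u} [Field k] [Algebra 𝒪 k]

section Dual

variable (𝒪 k) [Finite k]

/-- **The dual numbers `k[ε]`** as an object of `Ĉ_𝒪(k)` (augmentation `a + bε ↦ a`).
[cite: Mazur1997Deformation, §15] -/
def dualCNL : CNLAlgebra 𝒪 k :=
  haveI : Finite k[ε] := inferInstanceAs (Finite (k × k))
  haveI : IsArtinianRing k[ε] := isArtinian_of_finite
  { carrier := k[ε]
    residue := TrivSqZeroExt.fstHom 𝒪 k k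
    residue_surjective := fun a => ⟨TrivSqZeroExt.inl a, rfl⟩ }

/-- The underlying type of `dualCNL` is `k[ε]`. [folklore] -/
@[simp] theorem dualCNL_carrier : (dualCNL 𝒪 k : Type u) = k[ε] := rfl

/-- The augmentation of `dualCNL` is `fst`. [folklore] -/
theorem dualCNL_residue_apply (x : dualCNL 𝒪 k) : (dualCNL 𝒪 k).residue x = TrivSqZeroExt.fst x := rfl

end Dual

section SquareZero

variable (hk : Function.Surjective (algebraMap 𝒪 k)) (Q : CNLAlgebra 𝒪 k)
  (hsq : ∀ x y : Q, x ∈ maximalIdeal Q → y ∈ maximalIdeal Q → x * y = 0)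
  (hp : ∀ o : 𝒪, algebraMap 𝒪 k o = 0 → algebraMap 𝒪 Q o = 0)

/-- The splitting `k → Q` of the augmentation of a `𝔭`-torsion object. [folklore] -/
def splitting : k →+* Q :=
  (algebraMap 𝒪 k).liftOfSurjective hk ⟨algebraMap 𝒪 Q, fun o ho => hp o ho⟩

/-- The splitting on the image of `𝒪`. [folklore] -/
theorem splitting_algebraMap (o : 𝒪) : splitting hk Q hp (algebraMap 𝒪 k o) = algebraMap 𝒪 Q o :=
  (algebraMap 𝒪 k).liftOfSurjective_comp_apply hk ⟨algebraMap 𝒪 Q, fun o ho => hp o ho⟩ o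

/-- The splitting is a section of the augmentation. [folklore] -/
theorem residue_splitting (a : k) : Q.residue (splitting hk Q hp a) = a := by
  obtain ⟨o, rfl⟩ := hk a
  rw [splitting_algebraMap, AlgHom.commutes]

/-- `q - s(π q) ∈ 𝔪_Q`. [folklore] -/
theorem sub_splitting_mem (q : Q) : q - splitting hk Q hp (Q.residue q) ∈ maximalIdeal Q := by
  rw [CNLAlgebra.mem_maximalIdeal_iff, map_sub, residue_splitting, sub_self]

/-- The projection `q ↦ q - s(π q)` onto the maximal ideal. [folklore] -/
def toMax (q : Q) : maximalIdeal Q := ⟨q - splitting hk Q hp (Q.residue q), sub_splitting_mem hk Q hp q⟩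

/-- Unfolding lemma for `toMax`. [folklore] -/
@[simp] theorem coe_toMax (q : Q) : (toMax hk Q hp q : Q) = q - splitting hk Q hp (Q.residue q) := rfl

/-- `toMax` is additive. [folklore] -/
theorem toMax_add (q q' : Q) : toMax hk Q hp (q + q') = toMax hk Q hp q + toMax hk Q hp q' := by
  apply Subtype.ext
  simp only [coe_toMax, Submodule.coe_add, map_add]
  ring

/-- `toMax` is the identity on `𝔪_Q`. [folklore] -/
theorem toMax_of_mem {q : Q} (hq : q ∈ maximalIdeal Q) : toMax hk Q hp q = ⟨q, hq⟩ := by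
  apply Subtype.ext
  rw [coe_toMax, (Q.mem_maximalIdeal_iff).1 hq, map_zero, sub_zero]

/-- `toMax` kills the image of the splitting. [folklore] -/
theorem toMax_splitting (a : k) : toMax hk Q hp (splitting hk Q hp a) = 0 := by
  apply Subtype.ext
  rw [coe_toMax, residue_splitting, sub_self, Submodule.coe_zero]

include hsq in
/-- Leibniz rule in a split square-zero extension: `qq' - s(aa') = s(a)(q' - s a') + s(a')(q - s a)`.
[folklore] -/
theorem coe_toMax_mul (q q' : Q) : (toMax hk Q hp (q * q') : Q) =
    splitting hk Q hp (Q.residue q) * (toMax hk Q hp q' : Q) +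
      splitting hk Q hp (Q.residue q') * (toMax hk Q hp q : Q) := by
  have h0 := hsq _ _ (sub_splitting_mem hk Q hp q) (sub_splitting_mem hk Q hp q')
  simp only [coe_toMax, map_mul]
  linear_combination h0

end SquareZero

/-- **Tangent counting.**  Let `B ∈ Ĉ_𝒪(k)` (`k` finite) have at most `M` morphisms to `k[ε]`.
Then the relative cotangent space `𝔪_B/(𝔪_B² + 𝔭B)` is spanned by `M` elements: its `k`-dual
injects into `Hom_{Ĉ}(B, k[ε])` (a functional `λ` gives `b ↦ π(b) + ε λ(b - s π(b))` on the split
square-zero quotient `B/(𝔪_B² + 𝔭B)`), and a finite `k`-vector space has as many functionals as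
elements (Mazur §15–§17: `t_R = Hom_k(𝔪_R/(𝔪_R² + 𝔪_Λ R), k) = D(k[ε])`).
[cite: Mazur1997Deformation, §15 and §17] -/
theorem exists_cotGen_of_card_algHom_le [Finite k] (hk : Function.Surjective (algebraMap 𝒪 k))
    (B : CNLAlgebra 𝒪 k) [Finite (B →ₐ[𝒪] dualCNL 𝒪 k)] (M : ℕ)
    (hM : Nat.card (B →ₐ[𝒪] dualCNL 𝒪 k) ≤ M) : ∃ s : Fin M → B, CotGen B s := by
  classical
  -- the split square-zero quotient `Q = B/(𝔪² + 𝔭)`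
  let Q : CNLAlgebra 𝒪 k := B.quotient (cotIdeal B) (cotIdeal_ne_top B)
  haveI : Finite Q := finite_quotient_cotIdeal B
  have hQres : ∀ b : B, Q.residue (Ideal.Quotient.mk _ b) = B.residue b :=
    fun b => CNLAlgebra.quotient_residue_mk B _ _ b
  have hmkmem : ∀ b : B, (Ideal.Quotient.mk (cotIdeal B) b : Q) ∈ maximalIdeal Q ↔ b ∈ maximalIdeal B :=
    fun b => (Q.mem_maximalIdeal_iff).trans (by rw [hQres]; exact (B.mem_maximalIdeal_iff).symm)
  have hsq : ∀ x y : Q, x ∈ maximalIdeal Q → y ∈ maximalIdeal Q → x * y = 0 := by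
    intro x y hx hy
    obtain ⟨x', rfl⟩ := Ideal.Quotient.mk_surjective x
    obtain ⟨y', rfl⟩ := Ideal.Quotient.mk_surjective y
    have hx' := (hmkmem x').1 hx
    have hy' := (hmkmem y').1 hy
    change Ideal.Quotient.mk (cotIdeal B) (x' * y') = 0
    rw [Ideal.Quotient.eq_zero_iff_mem]
    exact le_sup_left (a := maximalIdeal B ^ 2) (by rw [sq]; exact Ideal.mul_mem_mul hx' hy')
  have hp : ∀ o : 𝒪, algebraMap 𝒪 k o = 0 → algebraMap 𝒪 Q o = 0 := by
    intro o ho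
    change Ideal.Quotient.mk (cotIdeal B) (algebraMap 𝒪 B o) = 0
    rw [Ideal.Quotient.eq_zero_iff_mem]
    exact le_sup_right (a := maximalIdeal B ^ 2) (Ideal.mem_map_of_mem _ ho)
  -- `𝔭` acts trivially on `Q`
  have hsmul0 : ∀ (o : 𝒪), algebraMap 𝒪 k o = 0 → ∀ q : Q, o • q = 0 := by
    intro o ho q
    rw [Algebra.smul_def, hp o ho, zero_mul]
  -- the `k`-vector space `W = 𝔪_Q`
  let W : Type u := maximalIdeal Q
  let σ : k → 𝒪 := Function.surjInv hk
  have hσ : ∀ a, algebraMap 𝒪 k (σ a) = a := Function.surjInv_eq hk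
  letI : SMul k W := ⟨fun a w => σ a • w⟩
  have hsmul_def : ∀ (a : k) (w : W), a • w = σ a • w := fun _ _ => rfl
  have hsmulW : ∀ (c : 𝒪) (w : W), algebraMap 𝒪 k c • w = c • w := by
    intro c w
    rw [hsmul_def, ← sub_eq_zero, ← sub_smul]
    apply Subtype.ext
    rw [Submodule.coe_smul_of_tower, Submodule.coe_zero]
    exact hsmul0 _ (by rw [map_sub, hσ, sub_self]) _
  letI : Module k W := Function.Surjective.moduleLeft (algebraMap 𝒪 k) hk hsmulW
  haveI : Finite W := Subtype.finite
  haveI : Module.Finite k W := Module.Finite.of_finite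
  have hcoe_smul : ∀ (a : k) (w : W), ((a • w : W) : Q) = splitting hk Q hp a * (w : Q) := by
    intro a w
    rw [hsmul_def, Submodule.coe_smul_of_tower, Algebra.smul_def, ← splitting_algebraMap hk Q hp, hσ]
  -- from a functional, a morphism `Q → k[ε]`: first the bare function
  let f : (W →ₗ[k] k) → Q → k[ε] := fun lam q =>
    TrivSqZeroExt.inl (Q.residue q) + TrivSqZeroExt.inr (lam (toMax hk Q hp q))
  have f_fst : ∀ lam q, TrivSqZeroExt.fst (f lam q) = Q.residue q := by
    intro lam q; simp [f]
  have f_snd : ∀ lam q, TrivSqZeroExt.snd (f lam q) = lam (toMax hk Q hp q) := by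
    intro lam q; simp [f]
  have f_one : ∀ lam, f lam 1 = 1 := by
    intro lam
    apply TrivSqZeroExt.ext
    · rw [f_fst, map_one, TrivSqZeroExt.fst_one]
    · rw [f_snd, TrivSqZeroExt.snd_one, show (1 : Q) = splitting hk Q hp 1 from (map_one _).symm,
        toMax_splitting, map_zero]
  have f_zero : ∀ lam, f lam 0 = 0 := by
    intro lam
    apply TrivSqZeroExt.ext
    · rw [f_fst, map_zero, TrivSqZeroExt.fst_zero]
    · rw [f_snd, TrivSqZeroExt.snd_zero, show (0 : Q) = splitting hk Q hp 0 from (map_zero _).symm,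
        toMax_splitting, map_zero]
  have f_add : ∀ lam q q', f lam (q + q') = f lam q + f lam q' := by
    intro lam q q'
    apply TrivSqZeroExt.ext
    · rw [f_fst, TrivSqZeroExt.fst_add, f_fst, f_fst, map_add]
    · rw [f_snd, TrivSqZeroExt.snd_add, f_snd, f_snd, toMax_add, map_add]
  have f_mul : ∀ lam q q', f lam (q * q') = f lam q * f lam q' := by
    intro lam q q'
    apply TrivSqZeroExt.ext
    · rw [f_fst, TrivSqZeroExt.fst_mul, f_fst, f_fst, map_mul]
    · rw [f_snd, TrivSqZeroExt.snd_mul, f_snd, f_snd, f_fst, f_fst]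
      have hv : toMax hk Q hp (q * q') =
          Q.residue q • toMax hk Q hp q' + Q.residue q' • toMax hk Q hp q := by
        apply Subtype.ext
        rw [Submodule.coe_add, hcoe_smul, hcoe_smul, coe_toMax_mul hk Q hsq hp]
      rw [hv, map_add, map_smul, map_smul, smul_eq_mul, smul_eq_mul,
        op_smul_eq_mul]
      ring
  have f_comm : ∀ lam (o : 𝒪), f lam (algebraMap 𝒪 Q o) = algebraMap 𝒪 k[ε] o := by
    intro lam o
    apply TrivSqZeroExt.ext
    · rw [f_fst, AlgHom.commutes, TrivSqZeroExt.algebraMap_eq_inl', TrivSqZeroExt.fst_inl]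
    · rw [f_snd, ← splitting_algebraMap hk Q hp, toMax_splitting, map_zero,
        TrivSqZeroExt.algebraMap_eq_inl', TrivSqZeroExt.snd_inl]
  let φ : (W →ₗ[k] k) → (Q →ₐ[𝒪] dualCNL 𝒪 k) := fun lam =>
    { toFun := f lam
      map_one' := f_one lam
      map_mul' := f_mul lam
      map_zero' := f_zero lam
      map_add' := f_add lam
      commutes' := f_comm lam }
  have hφ_apply : ∀ lam q, φ lam q = f lam q := fun _ _ => rfl
  have hφinj : Function.Injective φ := by
    intro lam lam' h
    apply LinearMap.ext
    intro w
    have h1 := DFunLike.congr_fun h (w : Q)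
    rw [hφ_apply, hφ_apply] at h1
    have h2 := congrArg TrivSqZeroExt.snd h1
    rwa [f_snd, f_snd, toMax_of_mem hk Q hp w.2] at h2
  -- compose with `B → Q` and count
  let Θ : (W →ₗ[k] k) → (B →ₐ[𝒪] dualCNL 𝒪 k) := fun lam =>
    (φ lam).comp (B.toQuotient (cotIdeal B) (cotIdeal_ne_top B))
  have hΘinj : Function.Injective Θ := by
    intro lam lam' h
    apply hφinj
    apply AlgHom.ext
    intro q
    obtain ⟨b, rfl⟩ := Ideal.Quotient.mk_surjective q
    exact DFunLike.congr_fun h b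
  have hcardW : Nat.card W ≤ M := by
    calc Nat.card W = Nat.card (W →ₗ[k] k) :=
          Nat.card_congr (Module.finBasis k W).toDualEquiv.toEquiv
      _ ≤ Nat.card (B →ₐ[𝒪] dualCNL 𝒪 k) := Nat.card_le_card_of_injective Θ hΘinj
      _ ≤ M := hM
  -- hence `finrank k W ≤ M`
  have hq2 : 2 ≤ Nat.card k := by
    haveI : Fintype k := Fintype.ofFinite k
    rw [Nat.card_eq_fintype_card]
    exact Fintype.one_lt_card
  have hf : Module.finrank k W ≤ M := by
    have h1 : Nat.card W = Nat.card k ^ Module.finrank k W := Module.natCard_eq_pow_finrank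
    have h2 : 2 ^ Module.finrank k W ≤ M := by
      calc 2 ^ Module.finrank k W ≤ Nat.card k ^ Module.finrank k W := Nat.pow_le_pow_left hq2 _
        _ = Nat.card W := h1.symm
        _ ≤ M := hcardW
    exact le_of_lt (lt_of_lt_of_le Nat.lt_two_pow_self h2)
  -- a basis of `W` gives cotangent generators of `Q`, hence of `B`
  let bW := Module.finBasis k W
  have hspan : maximalIdeal Q ≤ Ideal.span (Set.range fun i => (bW i : Q)) := by
    intro q hq
    have hrepr := bW.sum_repr ⟨q, hq⟩
    have : q = ∑ i, splitting hk Q hp (bW.repr ⟨q, hq⟩ i) * (bW i : Q) := by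
      conv_lhs => rw [show q = ((⟨q, hq⟩ : W) : Q) from rfl, ← hrepr]
      rw [Submodule.coe_sum]
      refine Finset.sum_congr rfl fun i _ => ?_
      rw [hcoe_smul]
    rw [this]
    exact Ideal.sum_mem _ fun i _ => Ideal.mul_mem_left _ _ (Ideal.subset_span ⟨i, rfl⟩)
  -- pad to `M` generators and lift to `B`
  let sQ : Fin M → Q := fun i =>
    if h : (i : ℕ) < Module.finrank k W then (bW ⟨i, h⟩ : Q) else 0
  have hsQmem : ∀ i, sQ i ∈ maximalIdeal Q := by
    intro i
    simp only [sQ]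
    split_ifs with h
    · exact (bW ⟨i, h⟩).2
    · exact Submodule.zero_mem _
  have hsQspan : maximalIdeal Q ≤ Ideal.span (Set.range sQ) := by
    refine le_trans hspan (Ideal.span_mono ?_)
    rintro _ ⟨j, rfl⟩
    refine ⟨⟨j, lt_of_lt_of_le j.2 hf⟩, ?_⟩
    simp only [sQ, dif_pos j.2]
  choose sB hsB using fun i => Ideal.Quotient.mk_surjective (I := cotIdeal B) (sQ i)
  refine ⟨sB, fun i => ?_, fun b hb => ?_⟩
  · rw [← hmkmem, hsB]
    exact hsQmem i
  · have h1 : (Ideal.Quotient.mk (cotIdeal B) b : Q) ∈ Ideal.span (Set.range sQ) :=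
      hsQspan ((hmkmem b).2 hb)
    have h2 : Ideal.span (Set.range sQ) = (Ideal.span (Set.range sB)).map (Ideal.Quotient.mk (cotIdeal B)) := by
      rw [Ideal.map_span, ← Set.range_comp]
      congr 1
      congr 1
      funext i
      exact (hsB i).symm
    rw [h2] at h1
    have h3 := Ideal.mem_comap.2 h1
    rw [Ideal.comap_map_of_surjective _ Ideal.Quotient.mk_surjective] at h3
    obtain ⟨y, hy, z, hz, hyz⟩ := Submodule.mem_sup.1 h3
    rw [← hyz]
    refine Ideal.add_mem _ (Ideal.mem_sup_left hy) (Ideal.mem_sup_right ?_)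
    have : z ∈ Ideal.comap (Ideal.Quotient.mk (cotIdeal B)) ⊥ := hz
    rwa [← RingHom.ker_eq_comap_bot, Ideal.mk_ker] at this

end TangentCounting


/-! ### Cotangent generators of completed polynomial algebras and of the level rings -/

section PointIdealGenerators

variable {𝒪 : Type u} [CommRing 𝒪] {k : Type u} [Field k] [Algebra 𝒪 k]
variable {σ : Type u} (c : σ → k) (o : σ → 𝒪) (ho : ∀ v, algebraMap 𝒪 k (o v) = c v)

/-- `f - C(f(o)) ∈ (X_v - o_v)`: Taylor expansion at a point, ideal-theoretically. [folklore] -/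
theorem sub_C_eval_mem_span (f : MvPolynomial σ 𝒪) :
    f - MvPolynomial.C (MvPolynomial.eval o f) ∈
      Ideal.span (Set.range fun v => MvPolynomial.X v - MvPolynomial.C (o v)) := by
  induction f using MvPolynomial.induction_on with
  | C a => simp
  | add f g hf hg =>
    have : f + g - MvPolynomial.C (MvPolynomial.eval o (f + g)) =
        (f - MvPolynomial.C (MvPolynomial.eval o f)) + (g - MvPolynomial.C (MvPolynomial.eval o g)) := by
      simp only [map_add]; ring
    rw [this]
    exact Ideal.add_mem _ hf hg
  | mul_X f v hf =>
    have : f * MvPolynomial.X v - MvPolynomial.C (MvPolynomial.eval o (f * MvPolynomial.X v)) =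
        f * (MvPolynomial.X v - MvPolynomial.C (o v)) +
          MvPolynomial.C (o v) * (f - MvPolynomial.C (MvPolynomial.eval o f)) := by
      simp only [map_mul, MvPolynomial.eval_X]; ring
    rw [this]
    exact Ideal.add_mem _ (Ideal.mul_mem_left _ _ (Ideal.subset_span ⟨v, rfl⟩))
      (Ideal.mul_mem_left _ _ hf)

include ho in
/-- **Generators of the point ideal**: `ker(X ↦ c) ⊆ (X_v - o_v) + 𝔭𝒪[X]` for any lift `o` of
`c`. [folklore] -/
theorem pointIdeal_le_span_sup : pointIdeal 𝒪 c ≤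
    Ideal.span (Set.range fun v => MvPolynomial.X v - MvPolynomial.C (o v)) ⊔
      (resKer 𝒪 k).map (MvPolynomial.C : 𝒪 →+* MvPolynomial σ 𝒪) := by
  intro f hf
  have heval : MvPolynomial.eval o f ∈ resKer 𝒪 k := by
    change algebraMap 𝒪 k (MvPolynomial.eval o f) = 0
    have h1 : algebraMap 𝒪 k (MvPolynomial.eval o f) = MvPolynomial.aeval c f := by
      rw [MvPolynomial.aeval_def, MvPolynomial.eval, MvPolynomial.map_eval₂Hom, RingHom.comp_id]
      simp only [ho]
      rfl
    rw [h1]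
    exact (mem_pointIdeal_iff 𝒪 c).1 hf
  have : f = (f - MvPolynomial.C (MvPolynomial.eval o f)) + MvPolynomial.C (MvPolynomial.eval o f) := by
    ring
  rw [this]
  exact Ideal.add_mem _ (Ideal.mem_sup_left (sub_C_eval_mem_span o f))
    (Ideal.mem_sup_right (Ideal.mem_map_of_mem _ heval))

variable (hk : Function.Surjective (algebraMap 𝒪 k)) [Finite σ] [IsNoetherianRing 𝒪]

include ho in
/-- The elements `X_v - o_v` generate the cotangent space of `𝒪[X]^_c`. [folklore] -/
theorem PowerSeriesAt.cotGen_X_sub :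
    CotGen (PowerSeriesAt.toCNL c hk)
      (fun v => PowerSeriesAt.X 𝒪 c v - algebraMap 𝒪 (PowerSeriesAt 𝒪 c) (o v)) := by
  haveI := PowerSeriesAt.isLocalRing c hk
  refine ⟨fun v => ?_, ?_⟩
  · rw [CNLAlgebra.mem_maximalIdeal_iff]
    change PowerSeriesAt.residue 𝒪 c _ = 0
    rw [map_sub, PowerSeriesAt.residue_X, AlgHom.commutes, ho, sub_self]
  · change maximalIdeal (PowerSeriesAt 𝒪 c) ≤ _
    rw [PowerSeriesAt.maximalIdeal_eq c hk]
    refine le_trans (Ideal.map_mono (pointIdeal_le_span_sup c o ho)) ?_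
    rw [Ideal.map_sup, Ideal.map_span, Ideal.map_map]
    refine sup_le_sup ?_ ?_
    · apply Ideal.span_mono
      rintro _ ⟨_, ⟨v, rfl⟩, rfl⟩
      refine ⟨v, ?_⟩
      simp only [map_sub, PowerSeriesAt.X]
      rfl
    · refine le_trans ?_ le_sup_right
      rw [show (algebraMap (MvPolynomial σ 𝒪) (PowerSeriesAt 𝒪 c)).comp MvPolynomial.C =
        algebraMap 𝒪 (PowerSeriesAt 𝒪 c) from rfl]
      rfl

end PointIdealGenerators

namespace LiftingCondition

variable {𝒪 : Type u} [CommRing 𝒪] {k : Type u} [Field k] [Algebra 𝒪 k]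
variable {Γ : Type u} [Group Γ] [TopologicalSpace Γ] {n : ℕ} {rbar : Γ →* GL (Fin n) k}
variable (𝒞 : LiftingCondition 𝒪 k Γ n rbar)
variable (hk : Function.Surjective (algebraMap 𝒪 k)) [IsNoetherianRing 𝒪]

section LevelSurj

variable (U : Subgroup Γ) [U.Normal] [Finite (Γ ⧸ U)] (hU : U ≤ rbar.ker)
  (hUo : ∀ ⦃H : Subgroup Γ⦄, U ≤ H → IsOpen (H : Set Γ))

/-- A lift `o : Γ/U × n × n → 𝒪` of the point `levelPoint`, depending only on the VALUE of the
entry (so that it is compatible between levels). [folklore] -/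
def levelPointLift : LevelVars (n := n) U → 𝒪 := fun v => Function.surjInv hk (levelPoint U hU v)

omit [IsNoetherianRing 𝒪] [Finite (Γ ⧸ U)] [TopologicalSpace Γ] in
/-- `levelPointLift` lifts `levelPoint`. [folklore] -/
theorem algebraMap_levelPointLift (v : LevelVars (n := n) U) :
    algebraMap 𝒪 k (levelPointLift hk U hU v) = levelPoint U hU v :=
  Function.surjInv_eq hk _

/-- The cotangent generators `x_{g,i,j} - õ_{g,i,j}` of `R_U` (entries of `ρ_U` shifted by
constant lifts of the residual entries). [folklore] -/
def levelGen (v : LevelVars (n := n) U) : 𝒞.levelRing hk U hU hUo :=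
  (levelAmbient hk U hU).toQuotient (𝒞.levelIdeal hk U hU) (𝒞.levelIdeal_ne_top hk U hU hUo)
    (PowerSeriesAt.X 𝒪 (levelPoint U hU) v -
      algebraMap 𝒪 (PowerSeriesAt 𝒪 (levelPoint U hU)) (levelPointLift hk U hU v))

/-- `levelGen (γ,i,j) = ρ_U(γ)_{ij} - õ`. [folklore] -/
theorem levelGen_mk (γ : Γ) (i j : Fin n) :
    𝒞.levelGen hk U hU hUo ⟨(γ : Γ ⧸ U), i, j⟩ = (𝒞.levelRep hk U hU hUo γ).val i j -
      algebraMap 𝒪 (𝒞.levelRing hk U hU hUo) (levelPointLift hk U hU ⟨(γ : Γ ⧸ U), i, j⟩) :=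
  (map_sub ((levelAmbient hk U hU).toQuotient _ (𝒞.levelIdeal_ne_top hk U hU hUo)) _ _).trans rfl

/-- **The entries of `ρ_U` (shifted by constants) generate the cotangent space of `R_U`.**
[cite: Mazur1997Deformation, §20 Prop. 2 (proof)] -/
theorem cotGen_levelRing : CotGen (𝒞.levelRing hk U hU hUo) (𝒞.levelGen hk U hU hUo) :=
  (PowerSeriesAt.cotGen_X_sub (levelPoint U hU) (levelPointLift hk U hU)
    (algebraMap_levelPointLift hk U hU) hk).map
    ((levelAmbient hk U hU).toQuotient (𝒞.levelIdeal hk U hU) (𝒞.levelIdeal_ne_top hk U hU hUo))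
    Ideal.Quotient.mk_surjective

end LevelSurj

/-! ### The tower of level rings along a cofinal sequence of open normal subgroups -/

section Tower

variable (U : ℕ → Subgroup Γ) [hUn : ∀ N, (U N).Normal] [hUf : ∀ N, Finite (Γ ⧸ U N)]
  (hU : ∀ N, U N ≤ rbar.ker) (hUo : ∀ N ⦃H : Subgroup Γ⦄, U N ≤ H → IsOpen (H : Set Γ))
  (hUanti : ∀ N, U (N + 1) ≤ U N)

/-- The level rings `R_N = R_{U_N}`. [cite: Mazur1997Deformation, §20 Prop. 2] -/
abbrev lvl (N : ℕ) : CNLAlgebra 𝒪 k := 𝒞.levelRing hk (U N) (hU N) (hUo N)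

/-- The tautological lifts `ρ_N`. [cite: Mazur1997Deformation, §20 Prop. 2] -/
abbrev lvlRep (N : ℕ) : Γ →* GL (Fin n) (𝒞.lvl hk U hU hUo N) := 𝒞.levelRep hk (U N) (hU N) (hUo N)

/-- `ρ_N` is admissible. [folklore] -/
theorem lvlRep_mem (N : ℕ) : 𝒞.lvlRep hk U hU hUo N ∈ 𝒞.carrier (𝒞.lvl hk U hU hUo N) :=
  𝒞.levelRep_mem hk (U N) (hU N) (hUo N)

include hUanti in
/-- `U_{N+1}` is in the kernel of `ρ_N`. [folklore] -/
theorem le_ker_lvlRep_succ (N : ℕ) : U (N + 1) ≤ (𝒞.lvlRep hk U hU hUo N).ker :=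
  le_trans (hUanti N) (𝒞.le_ker_levelRep hk (U N) (hU N) (hUo N))

/-- The transition maps `R_{N+1} → R_N` classifying `ρ_N` at level `N+1`.
[cite: Mazur1997Deformation, §20 Prop. 2] -/
def lvlTrans (N : ℕ) : 𝒞.lvl hk U hU hUo (N + 1) →ₐ[𝒪] 𝒞.lvl hk U hU hUo N :=
  𝒞.levelLift hk (U (N + 1)) (hU (N + 1)) (hUo (N + 1)) (𝒞.lvlRep_mem hk U hU hUo N)
    (𝒞.le_ker_lvlRep_succ hk U hU hUo hUanti N)

/-- `t_N ∘ ρ_{N+1} = ρ_N`. [cite: Mazur1997Deformation, §20 Prop. 2] -/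
theorem map_comp_lvlRep_succ (N : ℕ) :
    (GeneralLinearGroup.map (𝒞.lvlTrans hk U hU hUo hUanti N :
        𝒞.lvl hk U hU hUo (N + 1) →+* 𝒞.lvl hk U hU hUo N)).comp
      (𝒞.lvlRep hk U hU hUo (N + 1)) = 𝒞.lvlRep hk U hU hUo N :=
  𝒞.map_comp_levelRep hk (U (N + 1)) (hU (N + 1)) (hUo (N + 1)) (𝒞.lvlRep_mem hk U hU hUo N)
    (𝒞.le_ker_lvlRep_succ hk U hU hUo hUanti N)

/-- The entries of `ρ_N` form compatible families. [folklore] -/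
theorem lvlTrans_apply_val (N : ℕ) (γ : Γ) (i j : Fin n) :
    𝒞.lvlTrans hk U hU hUo hUanti N ((𝒞.lvlRep hk U hU hUo (N + 1) γ).val i j) =
      (𝒞.lvlRep hk U hU hUo N γ).val i j := by
  have h := DFunLike.congr_fun (𝒞.map_comp_lvlRep_succ hk U hU hUo hUanti N) γ
  rw [MonoidHom.comp_apply] at h
  have h2 := GeneralLinearGroup.map_apply (𝒞.lvlTrans hk U hU hUo hUanti N :
    𝒞.lvl hk U hU hUo (N + 1) →+* 𝒞.lvl hk U hU hUo N) i j (𝒞.lvlRep hk U hU hUo (N + 1) γ)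
  rw [h] at h2
  exact h2.symm

/-- **The transition maps are onto** (the entries of `ρ_N` are hit and generate).
[cite: Mazur1997Deformation, §20 Prop. 2 (proof)] -/
theorem lvlTrans_surjective (N : ℕ) : Function.Surjective (𝒞.lvlTrans hk U hU hUo hUanti N) := by
  refine (𝒞.cotGen_levelRing hk (U N) (hU N) (hUo N)).surjective_of_range hk _ fun v => ?_
  obtain ⟨q, i, j⟩ := v
  induction q using QuotientGroup.induction_on with
  | H γ =>
    refine ⟨𝒞.levelGen hk (U (N + 1)) (hU (N + 1)) (hUo (N + 1)) ⟨(γ : Γ ⧸ U (N + 1)), i, j⟩,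
      (𝒞.cotGen_levelRing hk (U (N + 1)) (hU (N + 1)) (hUo (N + 1))).1 _, ?_⟩
    change 𝒞.lvlTrans hk U hU hUo hUanti N (𝒞.levelGen hk (U (N + 1)) (hU (N + 1)) (hUo (N + 1)) _) =
      𝒞.levelGen hk (U N) (hU N) (hUo N) _
    rw [levelGen_mk, levelGen_mk, map_sub, AlgHom.commutes]
    exact congrArg₂ (· - ·) (𝒞.lvlTrans_apply_val hk U hU hUo hUanti N γ i j) rfl

end Tower

/-! ### The universal ring -/

section Universal

variable [Finite k]
variable (U : ℕ → Subgroup Γ) [hUn : ∀ N, (U N).Normal] [hUf : ∀ N, Finite (Γ ⧸ U N)]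
  (hU : ∀ N, U N ≤ rbar.ker) (hUo : ∀ N ⦃H : Subgroup Γ⦄, U N ≤ H → IsOpen (H : Set Γ))
  (hUanti : ∀ N, U (N + 1) ≤ U N) {d : ℕ}
  (hgen : ∀ N, ∃ s : Fin d → 𝒞.lvl hk U hU hUo N, CotGen (𝒞.lvl hk U hU hUo N) s)

local notation "Rlv" => 𝒞.lvl hk U hU hUo
local notation "Runiv" => 𝒞.univRing hk U hU hUo hUanti hgen

/-- Compatible cotangent generators of the tower (Kőnig + correction). [folklore] -/
def towerGens : ∀ N, Fin d → 𝒞.lvl hk U hU hUo N :=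
  (exists_compat_cotGen (𝒞.lvl hk U hU hUo) (𝒞.lvlTrans hk U hU hUo hUanti)
    (𝒞.lvlTrans_surjective hk U hU hUo hUanti) hgen).choose

/-- The tower generators generate cotangent spaces. [folklore] -/
theorem towerGens_cotGen (N : ℕ) : CotGen (𝒞.lvl hk U hU hUo N) (𝒞.towerGens hk U hU hUo hUanti hgen N) :=
  (exists_compat_cotGen (𝒞.lvl hk U hU hUo) (𝒞.lvlTrans hk U hU hUo hUanti)
    (𝒞.lvlTrans_surjective hk U hU hUo hUanti) hgen).choose_spec.1 N

/-- The tower generators are compatible. [folklore] -/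
theorem towerGens_compat (N : ℕ) (i : Fin d) :
    𝒞.lvlTrans hk U hU hUo hUanti N (𝒞.towerGens hk U hU hUo hUanti hgen (N + 1) i) =
      𝒞.towerGens hk U hU hUo hUanti hgen N i :=
  (exists_compat_cotGen (𝒞.lvl hk U hU hUo) (𝒞.lvlTrans hk U hU hUo hUanti)
    (𝒞.lvlTrans_surjective hk U hU hUo hUanti) hgen).choose_spec.2 N i

/-- **The universal ring `R = lim R_N`** of the lifting condition `𝒞` (as the object
`Λ_d/J_∞` of `Ĉ_𝒪(k)`). [cite: Mazur1997Deformation, §20 Prop. 2] -/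
def univRing : CNLAlgebra 𝒪 k :=
  limCNL hk (𝒞.lvl hk U hU hUo) (𝒞.towerGens hk U hU hUo hUanti hgen)
    (𝒞.towerGens_cotGen hk U hU hUo hUanti hgen)

/-- The projections `R → R_N`. [folklore] -/
def univProj (N : ℕ) : 𝒞.univRing hk U hU hUo hUanti hgen →ₐ[𝒪] 𝒞.lvl hk U hU hUo N :=
  limProj hk (𝒞.lvl hk U hU hUo) (𝒞.towerGens hk U hU hUo hUanti hgen)
    (𝒞.towerGens_cotGen hk U hU hUo hUanti hgen) N

/-- `t_N ∘ π_{N+1} = π_N`. [folklore] -/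
theorem lvlTrans_comp_univProj (N : ℕ) :
    (𝒞.lvlTrans hk U hU hUo hUanti N).comp (𝒞.univProj hk U hU hUo hUanti hgen (N + 1)) =
      𝒞.univProj hk U hU hUo hUanti hgen N :=
  t_comp_limProj hk _ _ _ _ (𝒞.towerGens_compat hk U hU hUo hUanti hgen) N

/-- The projections are onto. [folklore] -/
theorem univProj_surjective (N : ℕ) : Function.Surjective (𝒞.univProj hk U hU hUo hUanti hgen N) :=
  limProj_surjective hk _ _ _ N

/-- The projections are jointly injective. [folklore] -/
theorem univProj_jointly_injective (q : 𝒞.univRing hk U hU hUo hUanti hgen)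
    (h : ∀ N, 𝒞.univProj hk U hU hUo hUanti hgen N q = 0) : q = 0 :=
  limProj_jointly_injective hk _ _ _ q h

/-- Chevalley for the projections. [cite: Matsumura1987, Exercise 8.7] -/
theorem exists_ker_univProj_le (m : ℕ) : ∃ N, RingHom.ker (𝒞.univProj hk U hU hUo hUanti hgen N).toRingHom ≤
    maximalIdeal (𝒞.univRing hk U hU hUo hUanti hgen) ^ m :=
  exists_ker_limProj_le hk _ _ _ _ (𝒞.towerGens_compat hk U hU hUo hUanti hgen) m

/-- The kernels of the projections decrease. [folklore] -/
theorem ker_univProj_antitone :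
    Antitone fun N => RingHom.ker (𝒞.univProj hk U hU hUo hUanti hgen N).toRingHom :=
  ker_limProj_antitone hk _ _ _ _ (𝒞.towerGens_compat hk U hU hUo hUanti hgen)

/-- `R` maps onto the compatible families. [cite: Mazur1997Deformation, §20 Prop. 1] -/
theorem exists_univProj_eq (s : ∀ N, 𝒞.lvl hk U hU hUo N)
    (hs : ∀ N, 𝒞.lvlTrans hk U hU hUo hUanti N (s (N + 1)) = s N) :
    ∃ q : 𝒞.univRing hk U hU hUo hUanti hgen, ∀ N, 𝒞.univProj hk U hU hUo hUanti hgen N q = s N :=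
  exists_limProj_eq hk _ _ _ _ (𝒞.towerGens_compat hk U hU hUo hUanti hgen) s hs

/-- The entries of the universal lift: the elements of `R` projecting to the entries of the
`ρ_N`. [folklore] -/
def univEntry (γ : Γ) (i j : Fin n) : 𝒞.univRing hk U hU hUo hUanti hgen :=
  (𝒞.exists_univProj_eq hk U hU hUo hUanti hgen (fun N => (𝒞.lvlRep hk U hU hUo N γ).val i j)
    (fun N => 𝒞.lvlTrans_apply_val hk U hU hUo hUanti N γ i j)).choose

/-- `π_N` on the universal entries. [folklore] -/
theorem univProj_univEntry (N : ℕ) (γ : Γ) (i j : Fin n) :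
    𝒞.univProj hk U hU hUo hUanti hgen N (𝒞.univEntry hk U hU hUo hUanti hgen γ i j) =
      (𝒞.lvlRep hk U hU hUo N γ).val i j :=
  (𝒞.exists_univProj_eq hk U hU hUo hUanti hgen (fun N => (𝒞.lvlRep hk U hU hUo N γ).val i j)
    (fun N => 𝒞.lvlTrans_apply_val hk U hU hUo hUanti N γ i j)).choose_spec N

/-- The projections as a `ULift ℕ`-indexed family of ring homomorphisms (universe bookkeeping
for the jointly-injective axiom). [folklore] -/
def univProjHom (N : ULift.{u} ℕ) : Runiv →+* Rlv N.down :=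
  (𝒞.univProj hk U hU hUo hUanti hgen N.down : Runiv →+* Rlv N.down)

/-- The projections are jointly injective (family form). [folklore] -/
theorem univProj_jointly_injective' (q : Runiv)
    (h : ∀ N : ULift.{u} ℕ, 𝒞.univProjHom hk U hU hUo hUanti hgen N q = 0) : q = 0 :=
  𝒞.univProj_jointly_injective hk U hU hUo hUanti hgen q fun N => h ⟨N⟩

/-- The matrices of `ρ_N` are the projections of the universal entries. [folklore] -/
theorem lvlRep_val_eq_map (N : ULift.{u} ℕ) (γ : Γ) :
    (𝒞.lvlRep hk U hU hUo N.down γ).val =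
      (Matrix.of fun i j => 𝒞.univEntry hk U hU hUo hUanti hgen γ i j).map
        (𝒞.univProjHom hk U hU hUo hUanti hgen N) := by
  ext i j
  rw [Matrix.map_apply, Matrix.of_apply]
  exact (𝒞.univProj_univEntry hk U hU hUo hUanti hgen N.down γ i j).symm

/-- **The universal lift `ρ : Γ → GL_n(R)`**. [cite: Mazur1997Deformation, §20 Prop. 2] -/
def univRep : Γ →* GL (Fin n) Runiv :=
  glOfJointlyInjective (fun γ => Matrix.of fun i j => 𝒞.univEntry hk U hU hUo hUanti hgen γ i j)
    (𝒞.univProjHom hk U hU hUo hUanti hgen)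
    (𝒞.univProj_jointly_injective' hk U hU hUo hUanti hgen)
    (fun N => 𝒞.lvlRep hk U hU hUo N.down) (𝒞.lvlRep_val_eq_map hk U hU hUo hUanti hgen)

/-- The entries of the universal lift. [folklore] -/
theorem univRep_val_apply (γ : Γ) (i j : Fin n) :
    (𝒞.univRep hk U hU hUo hUanti hgen γ).val i j = 𝒞.univEntry hk U hU hUo hUanti hgen γ i j := rfl

/-- `π_N ∘ ρ = ρ_N`. [cite: Mazur1997Deformation, §20 Prop. 2] -/
theorem map_comp_univRep (N : ℕ) :
    (GeneralLinearGroup.map (𝒞.univProj hk U hU hUo hUanti hgen N : Runiv →+* Rlv N)).comp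
      (𝒞.univRep hk U hU hUo hUanti hgen) = 𝒞.lvlRep hk U hU hUo N :=
  map_comp_glOfJointlyInjective _ _ (𝒞.univProj_jointly_injective' hk U hU hUo hUanti hgen)
    (fun N => 𝒞.lvlRep hk U hU hUo N.down) (𝒞.lvlRep_val_eq_map hk U hU hUo hUanti hgen) ⟨N⟩

/-- `π_N` on the entries of `ρ`. [folklore] -/
theorem univProj_univRep_val (N : ℕ) (γ : Γ) (i j : Fin n) :
    𝒞.univProj hk U hU hUo hUanti hgen N ((𝒞.univRep hk U hU hUo hUanti hgen γ).val i j) =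
      (𝒞.lvlRep hk U hU hUo N γ).val i j :=
  𝒞.univProj_univEntry hk U hU hUo hUanti hgen N γ i j

/-- Reduction modulo `𝔪^{m+1}` of the universal ring factors through a level `R_N`.
[cite: Matsumura1987, Exercise 8.7] -/
theorem exists_factor_toTrunc (m : ℕ) :
    ∃ N, ∃ h : 𝒞.lvl hk U hU hUo N →ₐ[𝒪] (𝒞.univRing hk U hU hUo hUanti hgen).trunc m,
      h.comp (𝒞.univProj hk U hU hUo hUanti hgen N) =
        (𝒞.univRing hk U hU hUo hUanti hgen).toTrunc m := by
  obtain ⟨N, hN⟩ := 𝒞.exists_ker_univProj_le hk U hU hUo hUanti hgen (m + 1)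
  refine ⟨N, AlgHom.liftOfSurjective _ (𝒞.univProj_surjective hk U hU hUo hUanti hgen N) _ ?_,
    AlgHom.liftOfSurjective_comp _ _ _ _⟩
  intro q hq
  have hq' := hN hq
  change (𝒞.univRing hk U hU hUo hUanti hgen).toTrunc m q = 0
  rw [CNLAlgebra.toTrunc_eq_zero_iff]
  exact hq'

/-- **The universal lift is admissible**: `ρ ∈ 𝒞(R)`. [cite: Mazur1997Deformation, §20 Prop. 2] -/
theorem univRep_mem : 𝒞.univRep hk U hU hUo hUanti hgen ∈ 𝒞.carrier Runiv := by
  refine 𝒞.mem_of_jointly_injective (ι := ULift.{u} ℕ) (fun N => Rlv N.down)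
    (fun N => 𝒞.univProj hk U hU hUo hUanti hgen N.down)
    (𝒞.univProj_jointly_injective' hk U hU hUo hUanti hgen) ?_ fun N => ?_
  · -- continuity: reduction mod `𝔪^{m+1}` factors through some `R_N`, and `ρ_N(U_N) = 1`
    intro m
    cases m with
    | zero =>
      haveI : Subsingleton (Runiv ⧸ maximalIdeal Runiv ^ 0) :=
        Ideal.Quotient.subsingleton_iff.2 (by rw [pow_zero, Ideal.one_eq_top])
      have : ((GeneralLinearGroup.map (Ideal.Quotient.mk (maximalIdeal Runiv ^ 0))).comp
          (𝒞.univRep hk U hU hUo hUanti hgen)).ker = ⊤ := by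
        rw [eq_top_iff]
        intro γ _
        rw [MonoidHom.mem_ker]
        exact Units.ext (Subsingleton.elim _ _)
      rw [this]
      exact isOpen_univ
    | succ m =>
      obtain ⟨N, h, hh⟩ := 𝒞.exists_factor_toTrunc hk U hU hUo hUanti hgen m
      apply hUo N
      intro u hu
      have hu1 : 𝒞.lvlRep hk U hU hUo N u = 1 := 𝒞.le_ker_levelRep hk (U N) (hU N) (hUo N) hu
      rw [MonoidHom.mem_ker, MonoidHom.comp_apply]
      apply Units.ext
      ext i j
      rw [GeneralLinearGroup.map_apply, Units.val_one]
      change (𝒞.univRing hk U hU hUo hUanti hgen).toTrunc m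
        ((𝒞.univRep hk U hU hUo hUanti hgen u).val i j) = (1 : Matrix (Fin n) (Fin n) _) i j
      rw [← hh, AlgHom.comp_apply, univProj_univRep_val, hu1, Units.val_one]
      by_cases hij : i = j
      · subst hij; rw [Matrix.one_apply_eq, Matrix.one_apply_eq, map_one]
      · rw [Matrix.one_apply_ne hij, Matrix.one_apply_ne hij, map_zero]
  · show (GeneralLinearGroup.map (𝒞.univProj hk U hU hUo hUanti hgen N.down : Runiv →+* Rlv N.down)).comp
      (𝒞.univRep hk U hU hUo hUanti hgen) ∈ _
    rw [map_comp_univRep]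
    exact 𝒞.lvlRep_mem hk U hU hUo N.down

/-! #### Transitions of the tower and the tautological lifts -/

omit [IsNoetherianRing 𝒪] [Finite k] [TopologicalSpace Γ] hUn hUf in
include hUanti in
/-- `U` is antitone. [folklore] -/
theorem U_antitone : Antitone U := antitone_nat_of_succ_le hUanti

omit [Finite k] in
/-- The composite transitions carry the entries of `ρ_M` to those of `ρ_{M'}`. [folklore] -/
theorem transition_lvlRep_val (M' : ℕ) {M : ℕ} (h : M' ≤ M) (γ : Γ) (i j : Fin n) :
    transition (Rlv) (𝒞.lvlTrans hk U hU hUo hUanti) M' h ((𝒞.lvlRep hk U hU hUo M γ).val i j) =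
      (𝒞.lvlRep hk U hU hUo M' γ).val i j := by
  induction h using Nat.leRec with
  | refl => rw [transition_self]; rfl
  | le_succ_of_le h ih =>
    rw [transition_succ _ _ M' h]
    change transition (Rlv) (𝒞.lvlTrans hk U hU hUo hUanti) M' h
      (𝒞.lvlTrans hk U hU hUo hUanti _ ((𝒞.lvlRep hk U hU hUo (_ + 1) γ).val i j)) = _
    rw [lvlTrans_apply_val, ih]

omit [Finite k] in
/-- The composite transitions carry `ρ_M` to `ρ_{M'}`. [folklore] -/
theorem map_comp_transition (M' : ℕ) {M : ℕ} (h : M' ≤ M) :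
    (GeneralLinearGroup.map (transition (Rlv) (𝒞.lvlTrans hk U hU hUo hUanti) M' h :
        Rlv M →+* Rlv M')).comp (𝒞.lvlRep hk U hU hUo M) = 𝒞.lvlRep hk U hU hUo M' := by
  refine MonoidHom.ext fun γ => Units.ext ?_
  ext i j
  rw [MonoidHom.comp_apply, GeneralLinearGroup.map_apply]
  exact 𝒞.transition_lvlRep_val hk U hU hUo hUanti M' h γ i j

/-- `π_{M'} = transition ∘ π_M`. [folklore] -/
theorem transition_comp_univProj (M' : ℕ) {M : ℕ} (h : M' ≤ M) :
    (transition (Rlv) (𝒞.lvlTrans hk U hU hUo hUanti) M' h).comp (𝒞.univProj hk U hU hUo hUanti hgen M) =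
      𝒞.univProj hk U hU hUo hUanti hgen M' :=
  transition_comp_of_compat _ _ (𝒞.lvlTrans_comp_univProj hk U hU hUo hUanti hgen) M' h

/-! #### The universal property -/

variable (hcof : ∀ V : Subgroup Γ, V.Normal → IsOpen (V : Set Γ) → ∃ N, U N ≤ V)
variable {A : CNLAlgebra 𝒪 k} {ρ : Γ →* GL (Fin n) A} (hρ : ρ ∈ 𝒞.carrier A)

/-- The reductions `ρ_m = ρ mod 𝔪_A^{m+1}`. [folklore] -/
abbrev truncRep (A : CNLAlgebra 𝒪 k) (ρ : Γ →* GL (Fin n) A) (m : ℕ) : Γ →* GL (Fin n) (A.trunc m) :=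
  (GeneralLinearGroup.map (A.toTrunc m : A →+* A.trunc m)).comp ρ

omit [IsNoetherianRing 𝒪] [Finite k] in
include hρ in
/-- `ρ_m` is admissible. [folklore] -/
theorem truncRep_mem (m : ℕ) : truncRep A ρ m ∈ 𝒞.carrier (A.trunc m) := 𝒞.map_mem _ hρ

omit [IsNoetherianRing 𝒪] [Finite k] hUn hUf in
include hρ hcof in
/-- Some `U_N` acts trivially modulo `𝔪_A^{m+1}` (continuity of `ρ` and cofinality of `U`).
[cite: Mazur1997Deformation, §20 Prop. 1] -/
theorem exists_le_ker_truncRep (m : ℕ) : ∃ N, U N ≤ (truncRep A ρ m).ker :=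
  hcof _ (MonoidHom.normal_ker _) (𝒞.isAdicContinuous hρ (m + 1))

/-- A monotone choice of levels `μ m` with `U_{μ m}` trivial modulo `𝔪_A^{m+1}`. [folklore] -/
def lvIdx (m : ℕ) : ℕ :=
  ∑ i ∈ Finset.range (m + 1), (𝒞.exists_le_ker_truncRep U hcof hρ i).choose

omit [IsNoetherianRing 𝒪] [Finite k] hUn hUf in
/-- `μ` is monotone. [folklore] -/
theorem lvIdx_mono : Monotone (𝒞.lvIdx U hcof hρ) := fun a b hab =>
  Finset.sum_le_sum_of_subset (Finset.range_mono (by omega))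

omit [IsNoetherianRing 𝒪] [Finite k] hUn hUf in
include hUanti in
/-- `U_M` is trivial modulo `𝔪_A^{m+1}` for `M ≥ μ m`. [folklore] -/
theorem le_ker_truncRep_of_le (m : ℕ) {M : ℕ} (hM : 𝒞.lvIdx U hcof hρ m ≤ M) :
    U M ≤ (truncRep A ρ m).ker := by
  refine le_trans (U_antitone U hUanti (le_trans ?_ hM)) (𝒞.exists_le_ker_truncRep U hcof hρ m).choose_spec
  exact Finset.single_le_sum (f := fun i => (𝒞.exists_le_ker_truncRep U hcof hρ i).choose)
    (fun _ _ => Nat.zero_le _) (Finset.self_mem_range_succ m)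

/-- The classifying map of `ρ_m` at a level `M ≥ μ m`. [cite: Mazur1997Deformation, §20 Prop. 2] -/
def classify (m : ℕ) {M : ℕ} (hM : 𝒞.lvIdx U hcof hρ m ≤ M) : Rlv M →ₐ[𝒪] A.trunc m :=
  𝒞.levelLift hk (U M) (hU M) (hUo M) (𝒞.truncRep_mem hρ m) (𝒞.le_ker_truncRep_of_le U hUanti hcof hρ m hM)

omit [Finite k] in
/-- `classify` classifies `ρ_m`. [folklore] -/
theorem map_comp_classify (m : ℕ) {M : ℕ} (hM : 𝒞.lvIdx U hcof hρ m ≤ M) :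
    (GeneralLinearGroup.map (𝒞.classify hk U hU hUo hUanti hcof hρ m hM : Rlv M →+* A.trunc m)).comp
      (𝒞.lvlRep hk U hU hUo M) = truncRep A ρ m :=
  𝒞.map_comp_levelRep hk (U M) (hU M) (hUo M) _ _

omit [Finite k] in
/-- Uniqueness of the classifying map. [folklore] -/
theorem classify_unique (m : ℕ) {M : ℕ} (hM : 𝒞.lvIdx U hcof hρ m ≤ M) (ψ : Rlv M →ₐ[𝒪] A.trunc m)
    (hψ : (GeneralLinearGroup.map (ψ : Rlv M →+* A.trunc m)).comp (𝒞.lvlRep hk U hU hUo M) =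
      truncRep A ρ m) : ψ = 𝒞.classify hk U hU hUo hUanti hcof hρ m hM :=
  𝒞.levelLift_unique hk (U M) (hU M) (hUo M) _ _ ψ hψ

/-- The truncation maps `A/𝔪^{m'+1} → A/𝔪^{m+1}`. [folklore] -/
def truncFactor (A : CNLAlgebra 𝒪 k) {m m' : ℕ} (h : m ≤ m') : A.trunc m' →ₐ[𝒪] A.trunc m :=
  Ideal.Quotient.factorₐ 𝒪 (Ideal.pow_le_pow_right (Nat.succ_le_succ h))

omit [IsNoetherianRing 𝒪] [Finite k] in
/-- Truncations compose. [folklore] -/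
theorem truncFactor_comp_toTrunc (A : CNLAlgebra 𝒪 k) {m m' : ℕ} (h : m ≤ m') :
    (truncFactor A h).comp (A.toTrunc m') = A.toTrunc m := rfl

omit [IsNoetherianRing 𝒪] [Finite k] [TopologicalSpace Γ] in
/-- Truncation of `ρ_{m'}` is `ρ_m`. [folklore] -/
theorem map_truncFactor_comp_truncRep {m m' : ℕ} (h : m ≤ m') :
    (GeneralLinearGroup.map (truncFactor A h : A.trunc m' →+* A.trunc m)).comp (truncRep A ρ m') =
      truncRep A ρ m := by
  rw [truncRep, ← MonoidHom.comp_assoc, ← GeneralLinearGroup.map_comp]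
  rfl

omit [Finite k] in
/-- Compatibility of the classifying maps in `m` at a fixed level. [folklore] -/
theorem truncFactor_comp_classify {m m' : ℕ} (h : m ≤ m') {M : ℕ} (hM' : 𝒞.lvIdx U hcof hρ m' ≤ M) :
    (truncFactor A h).comp (𝒞.classify hk U hU hUo hUanti hcof hρ m' hM') =
      𝒞.classify hk U hU hUo hUanti hcof hρ m (le_trans (𝒞.lvIdx_mono U hcof hρ h) hM') := by
  refine 𝒞.classify_unique hk U hU hUo hUanti hcof hρ m _ _ ?_
  rw [show ((truncFactor A h).comp (𝒞.classify hk U hU hUo hUanti hcof hρ m' hM') : Rlv M →+* A.trunc m) =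
      (truncFactor A h : A.trunc m' →+* A.trunc m).comp
        (𝒞.classify hk U hU hUo hUanti hcof hρ m' hM' : Rlv M →+* A.trunc m') from rfl,
    GeneralLinearGroup.map_comp, MonoidHom.comp_assoc, map_comp_classify, map_truncFactor_comp_truncRep]

omit [Finite k] in
/-- Compatibility of the classifying maps in the level. [folklore] -/
theorem classify_comp_transition (m : ℕ) {M M' : ℕ} (hM : 𝒞.lvIdx U hcof hρ m ≤ M) (h : M ≤ M') :
    (𝒞.classify hk U hU hUo hUanti hcof hρ m hM).comp
      (transition (Rlv) (𝒞.lvlTrans hk U hU hUo hUanti) M h) =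
      𝒞.classify hk U hU hUo hUanti hcof hρ m (le_trans hM h) := by
  refine 𝒞.classify_unique hk U hU hUo hUanti hcof hρ m _ _ ?_
  rw [show ((𝒞.classify hk U hU hUo hUanti hcof hρ m hM).comp
      (transition (Rlv) (𝒞.lvlTrans hk U hU hUo hUanti) M h) : Rlv M' →+* A.trunc m) =
      (𝒞.classify hk U hU hUo hUanti hcof hρ m hM : Rlv M →+* A.trunc m).comp
        (transition (Rlv) (𝒞.lvlTrans hk U hU hUo hUanti) M h : Rlv M' →+* Rlv M) from rfl,
    GeneralLinearGroup.map_comp, MonoidHom.comp_assoc, map_comp_transition, map_comp_classify]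

/-- The level maps `f_m : R → A/𝔪_A^m` of the classifying morphism. [folklore] -/
def univLiftLevel (m : ℕ) : Runiv →ₐ[𝒪] A ⧸ maximalIdeal A ^ m :=
  (Ideal.Quotient.factorₐ 𝒪 (Ideal.pow_le_pow_right (Nat.le_succ m))).comp
    ((𝒞.classify hk U hU hUo hUanti hcof hρ m le_rfl).comp
      (𝒞.univProj hk U hU hUo hUanti hgen (𝒞.lvIdx U hcof hρ m)))

/-- `f_m` computed at any level `M ≥ μ m`. [folklore] -/
theorem univLiftLevel_eq (m : ℕ) {M : ℕ} (hM : 𝒞.lvIdx U hcof hρ m ≤ M) :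
    𝒞.univLiftLevel hk U hU hUo hUanti hgen hcof hρ m =
      (Ideal.Quotient.factorₐ 𝒪 (Ideal.pow_le_pow_right (Nat.le_succ m))).comp
        ((𝒞.classify hk U hU hUo hUanti hcof hρ m hM).comp (𝒞.univProj hk U hU hUo hUanti hgen M)) := by
  rw [univLiftLevel, ← 𝒞.transition_comp_univProj hk U hU hUo hUanti hgen _ hM, ← AlgHom.comp_assoc,
    classify_comp_transition]

/-- The level maps are compatible. [folklore] -/
theorem univLiftLevel_compat {m m' : ℕ} (hle : m ≤ m') :
    (Ideal.Quotient.factorₐ 𝒪 (Ideal.pow_le_pow_right hle)).comp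
      (𝒞.univLiftLevel hk U hU hUo hUanti hgen hcof hρ m') =
      𝒞.univLiftLevel hk U hU hUo hUanti hgen hcof hρ m := by
  have hfac : ∀ c : A.trunc m',
      Ideal.Quotient.factorₐ 𝒪 (Ideal.pow_le_pow_right hle)
        (Ideal.Quotient.factorₐ 𝒪 (Ideal.pow_le_pow_right (Nat.le_succ m')) c) =
      Ideal.Quotient.factorₐ 𝒪 (Ideal.pow_le_pow_right (Nat.le_succ m)) (truncFactor A hle c) := by
    intro c
    obtain ⟨a, rfl⟩ := Ideal.Quotient.mk_surjective c
    rfl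
  rw [𝒞.univLiftLevel_eq hk U hU hUo hUanti hgen hcof hρ m (𝒞.lvIdx_mono U hcof hρ hle),
    ← 𝒞.truncFactor_comp_classify hk U hU hUo hUanti hcof hρ hle le_rfl]
  apply AlgHom.ext
  intro q
  exact hfac _

/-- **Universal property, existence**: the morphism `R → A` classifying `ρ ∈ 𝒞(A)`.
[cite: Mazur1997Deformation, §20 Prop. 2] -/
def univLift : Runiv →ₐ[𝒪] A :=
  IsAdicComplete.liftAlgHom (maximalIdeal A) (𝒞.univLiftLevel hk U hU hUo hUanti hgen hcof hρ)
    (𝒞.univLiftLevel_compat hk U hU hUo hUanti hgen hcof hρ)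

/-- `univLift` reduces to `f_m` modulo `𝔪_A^m`. [folklore] -/
theorem mk_univLift (m : ℕ) (q : Runiv) :
    Ideal.Quotient.mk (maximalIdeal A ^ m) (𝒞.univLift hk U hU hUo hUanti hgen hcof hρ q) =
      𝒞.univLiftLevel hk U hU hUo hUanti hgen hcof hρ m q :=
  IsAdicComplete.mk_liftAlgHom _ _ _ m q

omit [Finite k] in
/-- `classify` on the entries of `ρ_M`. [folklore] -/
theorem classify_lvlRep_val (m : ℕ) {M : ℕ} (hM : 𝒞.lvIdx U hcof hρ m ≤ M) (γ : Γ) (i j : Fin n) :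
    𝒞.classify hk U hU hUo hUanti hcof hρ m hM ((𝒞.lvlRep hk U hU hUo M γ).val i j) =
      A.toTrunc m ((ρ γ).val i j) := by
  have h := DFunLike.congr_fun (𝒞.map_comp_classify hk U hU hUo hUanti hcof hρ m hM) γ
  rw [MonoidHom.comp_apply] at h
  have h2 := GeneralLinearGroup.map_apply (𝒞.classify hk U hU hUo hUanti hcof hρ m hM :
    Rlv M →+* A.trunc m) i j (𝒞.lvlRep hk U hU hUo M γ)
  rw [h] at h2
  exact h2.symm

/-- `univLift ∘ ρ_univ = ρ`. [cite: Mazur1997Deformation, §20 Prop. 2] -/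
theorem map_comp_univLift :
    (GeneralLinearGroup.map (𝒞.univLift hk U hU hUo hUanti hgen hcof hρ : Runiv →+* A)).comp
      (𝒞.univRep hk U hU hUo hUanti hgen) = ρ := by
  refine MonoidHom.ext fun γ => Units.ext ?_
  ext i j
  rw [MonoidHom.comp_apply, GeneralLinearGroup.map_apply]
  change 𝒞.univLift hk U hU hUo hUanti hgen hcof hρ ((𝒞.univRep hk U hU hUo hUanti hgen γ).val i j) = _
  refine A.eq_of_forall_mk_eq fun m => ?_
  rw [mk_univLift]
  change Ideal.Quotient.factorₐ 𝒪 (Ideal.pow_le_pow_right (Nat.le_succ m))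
    (𝒞.classify hk U hU hUo hUanti hcof hρ m le_rfl
      (𝒞.univProj hk U hU hUo hUanti hgen _ ((𝒞.univRep hk U hU hUo hUanti hgen γ).val i j))) = _
  rw [univProj_univRep_val, classify_lvlRep_val]
  rfl

/-- Any morphism `Θ : R → A` with `Θ ∘ ρ_univ = ρ` reduces, modulo `𝔪_A^{m+1}`, to the classifying
map at a deep enough level (Chevalley: `ker π_M ⊆ 𝔪_R^{m+1}`). [cite: Mazur1997Deformation, §20 Prop. 2] -/
theorem toTrunc_comp_eq_classify (Θ : Runiv →ₐ[𝒪] A)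
    (hΘ : (GeneralLinearGroup.map (Θ : Runiv →+* A)).comp (𝒞.univRep hk U hU hUo hUanti hgen) = ρ)
    (m : ℕ) {M : ℕ} (hM : 𝒞.lvIdx U hcof hρ m ≤ M)
    (hker : RingHom.ker (𝒞.univProj hk U hU hUo hUanti hgen M).toRingHom ≤ maximalIdeal Runiv ^ (m + 1)) :
    (A.toTrunc m).comp Θ =
      (𝒞.classify hk U hU hUo hUanti hcof hρ m hM).comp (𝒞.univProj hk U hU hUo hUanti hgen M) := by
  -- `(toTrunc m) ∘ Θ` kills `ker π_M`
  have hk' : RingHom.ker (𝒞.univProj hk U hU hUo hUanti hgen M).toRingHom ≤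
      RingHom.ker ((A.toTrunc m).comp Θ).toRingHom := by
    intro q hq
    change A.toTrunc m (Θ q) = 0
    rw [CNLAlgebra.toTrunc_eq_zero_iff]
    exact CNLAlgebra.map_pow_maximalIdeal_le hk Θ (m + 1) (Ideal.mem_map_of_mem _ (hker hq))
  set θ' := AlgHom.liftOfSurjective _ (𝒞.univProj_surjective hk U hU hUo hUanti hgen M) _ hk' with hθ'
  have hfac : θ'.comp (𝒞.univProj hk U hU hUo hUanti hgen M) = (A.toTrunc m).comp Θ :=
    AlgHom.liftOfSurjective_comp _ _ _ _
  rw [← hfac]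
  congr 1
  refine 𝒞.classify_unique hk U hU hUo hUanti hcof hρ m hM θ' ?_
  rw [← 𝒞.map_comp_univRep hk U hU hUo hUanti hgen M, ← MonoidHom.comp_assoc,
    ← GeneralLinearGroup.map_comp]
  rw [show (θ' : Rlv M →+* A.trunc m).comp (𝒞.univProj hk U hU hUo hUanti hgen M : Runiv →+* Rlv M) =
      (A.toTrunc m : A →+* A.trunc m).comp (Θ : Runiv →+* A) from congrArg AlgHom.toRingHom hfac,
    GeneralLinearGroup.map_comp, MonoidHom.comp_assoc, hΘ]

include hcof hρ in
/-- **Universal property, uniqueness**. [cite: Mazur1997Deformation, §20 Prop. 2] -/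
theorem univLift_unique (Ψ : Runiv →ₐ[𝒪] A)
    (hΨ : (GeneralLinearGroup.map (Ψ : Runiv →+* A)).comp (𝒞.univRep hk U hU hUo hUanti hgen) = ρ) :
    Ψ = 𝒞.univLift hk U hU hUo hUanti hgen hcof hρ := by
  refine IsAdicComplete.algHom_ext (maximalIdeal A) fun m => ?_
  cases m with
  | zero =>
    haveI : Subsingleton (A ⧸ maximalIdeal A ^ 0) :=
      Ideal.Quotient.subsingleton_iff.2 (by rw [pow_zero, Ideal.one_eq_top])
    exact AlgHom.ext fun _ => Subsingleton.elim _ _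
  | succ m =>
    obtain ⟨M₀, hM₀⟩ := 𝒞.exists_ker_univProj_le hk U hU hUo hUanti hgen (m + 1)
    set M := max M₀ (𝒞.lvIdx U hcof hρ m) with hMdef
    have hker : RingHom.ker (𝒞.univProj hk U hU hUo hUanti hgen M).toRingHom ≤ maximalIdeal Runiv ^ (m + 1) :=
      le_trans (𝒞.ker_univProj_antitone hk U hU hUo hUanti hgen (le_max_left _ _)) hM₀
    have h1 := 𝒞.toTrunc_comp_eq_classify hk U hU hUo hUanti hgen hcof hρ Ψ hΨ m (le_max_right _ _) hker
    have h2 := 𝒞.toTrunc_comp_eq_classify hk U hU hUo hUanti hgen hcof hρ _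
      (𝒞.map_comp_univLift hk U hU hUo hUanti hgen hcof hρ) m (le_max_right _ _) hker
    exact h1.trans h2.symm

include hcof hρ in
/-- **Universal property of `(R, ρ_univ)`** (Mazur §20 Prop. 2 for the lifting condition `𝒞`):
every admissible lift `ρ ∈ 𝒞(A)` to an object of `Ĉ_𝒪(k)` is `φ ∘ ρ_univ` for a unique morphism
`φ : R → A`. [cite: Mazur1997Deformation, §20 Prop. 2] -/
theorem existsUnique_univLift :
    ∃! φ : Runiv →ₐ[𝒪] A,
      (GeneralLinearGroup.map (φ : Runiv →+* A)).comp (𝒞.univRep hk U hU hUo hUanti hgen) = ρ :=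
  ⟨𝒞.univLift hk U hU hUo hUanti hgen hcof hρ, 𝒞.map_comp_univLift hk U hU hUo hUanti hgen hcof hρ,
    fun Ψ hΨ => 𝒞.univLift_unique hk U hU hUo hUanti hgen hcof hρ Ψ hΨ⟩

end Universal

/-! ### From finitely many `k[ε]`-points to the universal ring -/

section Main

variable [Finite k]
variable (U : ℕ → Subgroup Γ) [hUn : ∀ N, (U N).Normal] [hUf : ∀ N, Finite (Γ ⧸ U N)]
  (hU : ∀ N, U N ≤ rbar.ker) (hUo : ∀ N ⦃H : Subgroup Γ⦄, U N ≤ H → IsOpen (H : Set Γ))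
  (hUanti : ∀ N, U (N + 1) ≤ U N)
  (hcof : ∀ V : Subgroup Γ, V.Normal → IsOpen (V : Set Γ) → ∃ N, U N ≤ V)
  (hfin : (𝒞.carrier (dualCNL 𝒪 k)).Finite)

/-- Morphisms `R_N → k[ε]` inject into `𝒞(k[ε])` (universal property of `R_N`). [folklore] -/
theorem injective_map_comp_lvlRep (N : ℕ) :
    Function.Injective fun φ : 𝒞.lvl hk U hU hUo N →ₐ[𝒪] dualCNL 𝒪 k =>
      (⟨(GeneralLinearGroup.map (φ : 𝒞.lvl hk U hU hUo N →+* dualCNL 𝒪 k)).comp (𝒞.lvlRep hk U hU hUo N),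
        𝒞.map_mem φ (𝒞.lvlRep_mem hk U hU hUo N)⟩ : 𝒞.carrier (dualCNL 𝒪 k)) := by
  intro φ φ' h
  have h' := congrArg Subtype.val h
  simp only at h'
  have hmem : (GeneralLinearGroup.map (φ' : 𝒞.lvl hk U hU hUo N →+* dualCNL 𝒪 k)).comp
      (𝒞.lvlRep hk U hU hUo N) ∈ 𝒞.carrier (dualCNL 𝒪 k) := 𝒞.map_mem φ' (𝒞.lvlRep_mem hk U hU hUo N)
  have hker : U N ≤ ((GeneralLinearGroup.map (φ' : 𝒞.lvl hk U hU hUo N →+* dualCNL 𝒪 k)).comp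
      (𝒞.lvlRep hk U hU hUo N)).ker := by
    intro u hu
    rw [MonoidHom.mem_ker, MonoidHom.comp_apply, 𝒞.le_ker_levelRep hk (U N) (hU N) (hUo N) hu, map_one]
  exact (𝒞.levelLift_unique hk (U N) (hU N) (hUo N) hmem hker φ h').trans
    (𝒞.levelLift_unique hk (U N) (hU N) (hUo N) hmem hker φ' rfl).symm

include hfin in
/-- **Finitely many `k[ε]`-points of `𝒞` bound the number of cotangent generators of every `R_N`
uniformly** (by `#𝒞(k[ε])`). [cite: Mazur1997Deformation, §15 and §20 Prop. 2] -/
theorem exists_cotGen_lvl (N : ℕ) :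
    ∃ s : Fin (Nat.card (𝒞.carrier (dualCNL 𝒪 k))) → 𝒞.lvl hk U hU hUo N,
      CotGen (𝒞.lvl hk U hU hUo N) s := by
  haveI : Finite (𝒞.carrier (dualCNL 𝒪 k)) := hfin.to_subtype
  haveI : Finite (𝒞.lvl hk U hU hUo N →ₐ[𝒪] dualCNL 𝒪 k) :=
    Finite.of_injective _ (𝒞.injective_map_comp_lvlRep hk U hU hUo N)
  exact exists_cotGen_of_card_algHom_le hk _ _
    (Nat.card_le_card_of_injective _ (𝒞.injective_map_comp_lvlRep hk U hU hUo N))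

include hk U hU hUo hUanti hcof hfin in
/-- **Mazur's representability theorem for a lifting condition with finitely many `k[ε]`-points**
(Mazur §20 Prop. 2, with the `p`-finiteness hypothesis `Φ_p` entering exactly through the
finiteness of `𝒞(k[ε])`, and Schlessinger's criterion replaced by the explicit construction
`R = lim_N R_{U_N}` along a cofinal sequence of open normal subgroups): there is an object `R` of
`Ĉ_𝒪(k)` with an admissible lift `ρ_R ∈ 𝒞(R)` such that every admissible lift `ρ ∈ 𝒞(A)`,
`A ∈ Ĉ_𝒪(k)`, is `φ ∘ ρ_R` for a unique morphism `φ : R → A`.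
[cite: Mazur1997Deformation, §20 Prop. 2] -/
theorem exists_universal_of_finite :
    ∃ (R : CNLAlgebra 𝒪 k) (ρR : Γ →* GL (Fin n) R), ρR ∈ 𝒞.carrier R ∧
      ∀ (A : CNLAlgebra 𝒪 k) (ρ : Γ →* GL (Fin n) A), ρ ∈ 𝒞.carrier A →
        ∃! φ : R →ₐ[𝒪] A, (GeneralLinearGroup.map (φ : R →+* A)).comp ρR = ρ :=
  ⟨𝒞.univRing hk U hU hUo hUanti (𝒞.exists_cotGen_lvl hk U hU hUo hfin),
    𝒞.univRep hk U hU hUo hUanti _, 𝒞.univRep_mem hk U hU hUo hUanti _,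
    fun _ _ hρ => 𝒞.existsUnique_univLift hk U hU hUo hUanti _ hcof hρ⟩

end Main

end LiftingCondition

end Literature.NumberTheory.GaloisRepresentations.Deformation
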